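import Literature.NumberTheory.Sieve.ModularInverseAdditiveEnergy
import Literature.NumberTheory.Sieve.FouvryTenenbaumDivisorAPWeilProofs
import HarnessLib

/-!
# Heath-Brown's second auxiliary bound for `d₃` in progressions (Lemma 7), in `g_s`-box form

Topic `Literature/NumberTheory/Sieve` (a brick of Fouvry–Tenenbaum's Lemma 4.13 = Heath-Brown's
Theorem 1; companion of `ModularInverseAdditiveEnergy.lean` and `FouvryTenenbaumDivisorAPProofs.lean`).
Source: D. R. Heath-Brown, *The divisor function `d₃(n)` in arithmetic progressions*, Acta Arith. 47
(1986) 29–56 [HeathBrown1986d3], §6 "The second auxiliary bound", pp. 45–47, (6.1)–(6.5) and Lemma 7.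
Everything here is PROVED.

## The printed argument (p. 45–47)

"Our starting point is (2.8). On putting `N₁(U, V, W) = N₁ = q⁻¹ ∑*_{u∈𝓘} ∑*_{v∈𝒥} F_q(0)`, which is
independent of `a`, we find `N(U, V, W) − N₁ ≪ q⁻¹ ∑_u ∑_{t=1}^{q−1} |F_q(t)|·|∑_v e_q(atūv̄)|`. Let
`n(k) = ∑_{u,t} |F_q(t)|`, where the sum is for (6.1) `u ∈ 𝓘, (u, q) = 1, 1 ≤ t ≤ q − 1,
atū ≡ k (mod q)`. Then, by Hölder's inequality, we obtain
(6.2) `N(U,V,W) − N₁ ≪ q⁻¹ ∑_k n(k)|∑_v e_q(kv̄)| ≪ q⁻¹ {∑ n(k)}^{1/2} {∑ n(k)²}^{1/4} {∑_k |∑_v e_q(kv̄)|⁴}^{1/4}`.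
From (2.9) we have (6.3) `∑_k n(k) = ∑_{u,t} |F_q(t)| ≪ I ∑_{t=1}^{q−1} ‖t/q‖⁻¹ ≪ qI log q`.
To estimate `∑ n(k)²` we shift the range of `t` in the definition (6.1) so that `0 < |t| ≤ q/2`. We
then split up this new range into intervals `T < |t| ≤ 2T`, where `T` runs over powers of `2`, and
`1/2 ≤ T ≤ q`. We write `n(k) = ∑ n(k, T)` accordingly, and note that
`n(k, T) ≪ min(K, qT⁻¹) #{(u, t); u ∈ 𝓘, T < |t| ≤ 2T, atū ≡ k (mod q)}`. Thus
`∑_k n(k, T)² ≪ min(K², q²T⁻²) #{(u₁, u₂, t₁, t₂); at₁ū₁ ≡ at₂ū₂ (mod q)}`. The congruence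
condition requires `t₁u₂ ≡ t₂u₁ (mod q)`. There are `O(TI)` pairs `(t₂, u₁)`. Moreover the number of
integers `n` for which `n ≡ t₂u₁ (mod q)` and `TU < |n| ≤ 2TζU` is `O(1 + TUq⁻¹)`; and for each
such `n` there are `O(X^ε)` solutions `t₁, u₂` of `t₁u₂ = n`. Hence … by Cauchy's inequality,
(6.4) `∑_k n(k)² ≪ X^ε (log q)² (qIK + qUI)`. Finally we observe that (6.5)
`∑_k |∑_v e_q(kv̄)|⁴ = qH`, … [(6.6)–(6.13): `ModularInverseAdditiveEnergy.lean`] … The estimate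
(6.13), together with (6.2), (6.3), (6.4) and (6.5) yields:
LEMMA 7. `N(U, V, W) − N₁(U, V, W) ≪ X^ε I^{3/4} J^{1/2} (K + U)^{1/4} {1 + V²q⁻¹ + V^{3/2}q^{−1/2}}^{1/4}`."

## What is formalized (namespace `HeathBrown1986`)

The modulus is called `s` (Fouvry–Tenenbaum's notation), the boxes carry classes `mod D`, `(D,s)=1`:
`B₁ = {L₁ < u ≤ R₁ : u ≡ t₁}`, `B₂ = {A < v ≤ B : v ≡ t₂} ⊆ (V, 2V]`, `B₃ = {L₃ < w ≤ R₃ : w ≡ t₃}`,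
and `N − (main term)` is the sum of `g_s(uvw; a) = 𝟙_{uvw ≡ a (s)} − 𝟙_{(uvw,s)=1}/φ(s)`.
* `d0`, `crep` (distance to `0` and centred representative in `ℤ/sℤ`), `blk` (the dyadic blocks
  `2^j ≤ |t| < 2^{j+1}`), `card_sol_blk_le` (the count of `t₁u₂ ≡ t₂u₁`), **`sum_sq_nk_le` = (6.4)**
  with explicit constant `4(log₂ s + 1)² M s I (R₁ + K')`, `M ≥ d(n)` for `n ≤ 2sR₁`;
* `sum_norm_sq_fourier` (Plancherel on `ℤ/sℤ`), `sq_sum_stdAddChar_inv_eq`,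
  **`sum_norm_pow_four_eq` = (6.5)** (`∑_k |∑_{v} e_s(kv̄)|⁴ = s·H(𝒥, s)`, `H = invEnergy`);
* `holder_main` = (6.2), `sum_nk_le` = (6.3) (`∑_{t≠0} 1/(2‖t/s‖) ≤ s(1 + log s)`);
* `sum_gAP_three_eq_fourier` (the expansion (2.8) in `w`, from `lemma412_sum_gAP_eq_fourier`),
  `norm_sum_box_stdAddChar_le` (`|F(t)| ≤ 1/(2‖tD/s‖)`), `norm_E_le`, `main_term_pow_four_le`;
* **`sum3_gAP_le`** — Lemma 7 in this language: for every `ε > 0` there is `C` with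
  `|∑_{B₁×B₂×B₃} g_s(uvw; a)| ≤ (C (sV)^ε d(s) M (1+log s)²(log₂ s+1)² #B₁³ (R₁ + (R₃−L₃)/D + 1)`
  `((B−A)+1)² (1 + V²/s + V^{3/2}s^{−1/2}))^{1/4} + #B₁ #B₂ d(s)(1 + log s)/φ(s)`,
  i.e. `X^ε I^{3/4} J^{1/2} (K/D + 1 + U)^{1/4} (1 + V²/s + V^{3/2}s^{−1/2})^{1/4}` plus the
  (negligible) cost `IJ d(s) log s/φ(s)` of replacing Heath-Brown's `N₁` by the `φ(s)`-normalised main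
  term of `g_s` (the Ramanujan sums `c_s(t)`, `t ≠ 0`).  The classes `mod D` are absorbed by
  `t ↦ tD`, `a ↦ −aD̄` and the monotonicity of every count in the boxes (as anticipated by
  Fouvry–Tenenbaum, p. 20: "we skip the details").

## References

* D. R. Heath-Brown, Acta Arith. 47 (1986) 29–56, §6 (6.1)–(6.5), Lemma 7. [HeathBrown1986d3]
* D. R. Heath-Brown, Math. Proc. Cambridge Philos. Soc. 83 (1978) 357–375, pp. 366–368; and
  R. Balasubramanian, J. B. Conrey, D. R. Heath-Brown, J. Reine Angew. Math. 357 (1985) 161–181,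
  proof of Lemma 7 (the methods, cited as [13], [1] on p. 45).
* É. Fouvry, G. Tenenbaum, *Multiplicative functions in large arithmetic progressions and
  applications*, Trans. Amer. Math. Soc. (2021), doi:10.1090/tran/8442, Lemma 4.13 and p. 20.
  [FouvryTenenbaum2021]
-/

open Finset

noncomputable section

namespace Literature.NumberTheory.Sieve

namespace HeathBrown1986

open Literature.NumberTheory.Sieve.Vinogradov (distInt distInt_nonneg)

/-! ### Distance to `0` in `ℤ/sℤ` and the centred representative -/

/-- `d0 t = min(t.val, s − t.val)`, the distance from `t` to `0` around the circle `ℤ/sℤ`. [folklore] -/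
def d0 {s : ℕ} (t : ZMod s) : ℕ := min t.val (s - t.val)

/-- The centred representative of `t ∈ ℤ/sℤ` (in `(−s/2, s/2]`). [folklore] -/
def crep {s : ℕ} (t : ZMod s) : ℤ := if t.val ≤ s - t.val then (t.val : ℤ) else (t.val : ℤ) - s

/-- `crep t ≡ t`. [folklore] -/
theorem crep_cast {s : ℕ} [NeZero s] (t : ZMod s) : ((crep t : ℤ) : ZMod s) = t := by
  unfold crep
  split_ifs
  · push_cast; exact ZMod.natCast_zmod_val t
  · push_cast; rw [ZMod.natCast_self, sub_zero]; exact ZMod.natCast_zmod_val t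

/-- `|crep t| = d0 t`. [folklore] -/
theorem natAbs_crep {s : ℕ} [NeZero s] (t : ZMod s) : (crep t).natAbs = d0 t := by
  have hv : t.val < s := ZMod.val_lt t
  unfold crep d0
  split_ifs with h
  · rw [Int.natAbs_natCast, min_eq_left h]
  · push Not at h
    rw [min_eq_right h.le]
    have : ((t.val : ℤ) - s) = -((s - t.val : ℕ) : ℤ) := by
      rw [Nat.cast_sub hv.le]; ring
    rw [this, Int.natAbs_neg, Int.natAbs_natCast]

/-- `d0 t ≥ 1` for `t ≠ 0`. [folklore] -/
theorem d0_pos {s : ℕ} [NeZero s] {t : ZMod s} (ht : t ≠ 0) : 0 < d0 t := by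
  have hv : t.val < s := ZMod.val_lt t
  have hv0 : t.val ≠ 0 := fun h => ht ((ZMod.val_eq_zero t).mp h)
  unfold d0
  exact lt_min (Nat.pos_of_ne_zero hv0) (by omega)

/-- `2 d0 t ≤ s`. [folklore] -/
theorem two_mul_d0_le {s : ℕ} [NeZero s] (t : ZMod s) : 2 * d0 t ≤ s := by
  have hv : t.val < s := ZMod.val_lt t
  unfold d0
  rcases le_total t.val (s - t.val) with h | h
  · rw [min_eq_left h]; omega
  · rw [min_eq_right h]; omega

/-- `d0 t ≤ s`. [folklore] -/
theorem d0_le {s : ℕ} [NeZero s] (t : ZMod s) : d0 t ≤ s := by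
  have := two_mul_d0_le t; omega

/-- `crep t ≠ 0` for `t ≠ 0`. [folklore] -/
theorem crep_ne_zero {s : ℕ} [NeZero s] {t : ZMod s} (ht : t ≠ 0) : crep t ≠ 0 := by
  intro h
  have := d0_pos ht
  rw [← natAbs_crep, h, Int.natAbs_zero] at this
  exact lt_irrefl _ this

/-- At most `2N` residues have `d0 < N`. [folklore] -/
theorem card_filter_d0_lt_le {s : ℕ} [NeZero s] (N : ℕ) :
    ((Finset.univ : Finset (ZMod s)).filter (fun t => d0 t < N)).card ≤ 2 * N := by
  classical
  have hsub : (Finset.univ : Finset (ZMod s)).filter (fun t => d0 t < N) ⊆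
      (Finset.univ.filter (fun t : ZMod s => t.val < N)) ∪
        (Finset.univ.filter (fun t : ZMod s => s - N < t.val)) := by
    intro t ht
    rw [Finset.mem_filter] at ht
    rw [Finset.mem_union, Finset.mem_filter, Finset.mem_filter]
    unfold d0 at ht
    rcases lt_or_ge t.val N with h | h
    · left; exact ⟨Finset.mem_univ _, h⟩
    · right
      refine ⟨Finset.mem_univ _, ?_⟩
      have : s - t.val < N := by
        have := ht.2; rw [min_def] at this; split_ifs at this <;> omega
      have hv : t.val < s := ZMod.val_lt t
      omega
  have h1 : (Finset.univ.filter (fun t : ZMod s => t.val < N)).card ≤ N := by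
    calc (Finset.univ.filter (fun t : ZMod s => t.val < N)).card ≤ (Finset.range N).card :=
          Finset.card_le_card_of_injOn ZMod.val (fun t ht => by
            rw [Finset.mem_coe, Finset.mem_filter] at ht
            exact Finset.mem_coe.mpr (Finset.mem_range.mpr ht.2))
            (fun a _ b _ h => ZMod.val_injective s h)
      _ = N := Finset.card_range N
  have h2 : (Finset.univ.filter (fun t : ZMod s => s - N < t.val)).card ≤ N := by
    calc (Finset.univ.filter (fun t : ZMod s => s - N < t.val)).card ≤ (Finset.Ioo (s - N) s).card :=
          Finset.card_le_card_of_injOn ZMod.val (fun t ht => by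
            rw [Finset.mem_coe, Finset.mem_filter] at ht
            exact Finset.mem_coe.mpr (Finset.mem_Ioo.mpr ⟨ht.2, ZMod.val_lt t⟩))
            (fun a _ b _ h => ZMod.val_injective s h)
      _ ≤ N := by rw [Nat.card_Ioo]; omega
  calc ((Finset.univ : Finset (ZMod s)).filter (fun t => d0 t < N)).card
      ≤ ((Finset.univ.filter (fun t : ZMod s => t.val < N)) ∪
          (Finset.univ.filter (fun t : ZMod s => s - N < t.val))).card := Finset.card_le_card hsub
    _ ≤ _ := Finset.card_union_le _ _
    _ ≤ 2 * N := by omega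

/-- `‖k/s‖ ≥ d0(k)/s`: the distance from `t.val/s` to the nearest integer. [folklore] -/
theorem d0_div_le_distInt {s : ℕ} [NeZero s] (t : ZMod s) :
    (d0 t : ℝ) / s ≤ distInt ((t.val : ℝ) / s) := by
  have hs : 0 < s := Nat.pos_of_ne_zero (NeZero.ne s)
  have hsR : (0 : ℝ) < s := by exact_mod_cast hs
  have hv : t.val < s := ZMod.val_lt t
  unfold distInt
  set n : ℤ := round ((t.val : ℝ) / s) with hn
  -- for any integer `n`, `|k/s − n| ≥ min(k, s − k)/s`
  have key : ∀ m : ℤ, (d0 t : ℝ) / s ≤ |(t.val : ℝ) / s - m| := by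
    intro m
    have hd1 : (d0 t : ℝ) ≤ t.val := by exact_mod_cast min_le_left _ _
    have hd2 : (d0 t : ℝ) ≤ ((s - t.val : ℕ) : ℝ) := by exact_mod_cast min_le_right _ _
    rw [Nat.cast_sub hv.le] at hd2
    rcases le_or_gt m 0 with hm | hm
    · have hmR : (m : ℝ) ≤ 0 := by exact_mod_cast hm
      have h0 : (0 : ℝ) ≤ (t.val : ℝ) / s := by positivity
      rw [abs_of_nonneg (by linarith)]
      -- `k/s - m ≥ k/s ≥ d0/s`
      have : (d0 t : ℝ) / s ≤ (t.val : ℝ) / s := div_le_div_of_nonneg_right hd1 hsR.le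
      linarith
    · have hmR : (1 : ℝ) ≤ m := by exact_mod_cast hm
      have hlt : (t.val : ℝ) / s < 1 := by rw [div_lt_one hsR]; exact_mod_cast hv
      rw [abs_of_neg (by linarith)]
      have : (d0 t : ℝ) / s ≤ 1 - (t.val : ℝ) / s := by
        rw [le_sub_iff_add_le, ← le_sub_iff_add_le', show (1 : ℝ) - (d0 t : ℝ) / s = ((s : ℝ) - d0 t) / s by
          field_simp]
        exact div_le_div_of_nonneg_right (by linarith) hsR.le
      linarith
  exact key n

/-! ### Residue classes in an integer interval -/

/-- The integers `−N ≤ n ≤ N` in a fixed class `mod s` number at most `2N/s + 2`. [folklore] -/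
theorem card_Icc_filter_intCast_eq_le {s : ℕ} (hs : 0 < s) (N : ℕ) (c : ZMod s) :
    ((((Finset.Icc (-(N : ℤ)) N).filter (fun n : ℤ => (n : ZMod s) = c)).card : ℕ) : ℝ) ≤
      2 * (N : ℝ) / s + 2 := by
  classical
  haveI : NeZero s := ⟨hs.ne'⟩
  have hsR : (0 : ℝ) < s := by exact_mod_cast hs
  set F := (Finset.Icc (-(N : ℤ)) N).filter (fun n : ℤ => (n : ZMod s) = c) with hF
  -- shift to naturals `m = n + N`, `0 ≤ m ≤ 2N`, all `≡ c + N (mod s)`; then divide by `s`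
  set c' : ZMod s := c + (N : ZMod s) with hc'
  have hmap : ∀ n ∈ F, ((n + N).toNat : ZMod s) = c' ∧ (n + N).toNat ≤ 2 * N := by
    intro n hn
    rw [hF, Finset.mem_filter, Finset.mem_Icc] at hn
    have h0 : 0 ≤ n + N := by linarith [hn.1.1]
    have e : ((n + N).toNat : ℤ) = n + N := Int.toNat_of_nonneg h0
    constructor
    · have : (((n + N).toNat : ℤ) : ZMod s) = ((n + N : ℤ) : ZMod s) := by rw [e]
      rw [Int.cast_natCast] at this
      rw [this]; push_cast; rw [hn.2]
    · have : ((n + N).toNat : ℤ) ≤ 2 * N := by rw [e]; linarith [hn.1.2]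
      exact_mod_cast this
  -- inject into `{m ≤ 2N : m ≡ c'}` and then into multiples: `m = c'.val + s k`? simpler: `m ↦ m / s`
  -- is injective on a class.
  have hinj : Set.InjOn (fun n : ℤ => (n + N).toNat / s) (F : Set ℤ) := by
    intro n₁ h₁ n₂ h₂ heq
    have k₁ := hmap n₁ (Finset.mem_coe.mp h₁)
    have k₂ := hmap n₂ (Finset.mem_coe.mp h₂)
    rw [hF, Finset.coe_filter, Set.mem_setOf_eq, Finset.mem_Icc] at h₁ h₂
    have e₁ : ((n₁ + N).toNat : ℤ) = n₁ + N := Int.toNat_of_nonneg (by linarith [h₁.1.1])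
    have e₂ : ((n₂ + N).toNat : ℤ) = n₂ + N := Int.toNat_of_nonneg (by linarith [h₂.1.1])
    -- same class and same quotient ⇒ equal
    have hmod : (n₁ + N).toNat % s = (n₂ + N).toNat % s := by
      have := k₁.1.trans k₂.1.symm
      rw [ZMod.natCast_eq_natCast_iff'] at this
      exact this
    have : (n₁ + N).toNat = (n₂ + N).toNat := by
      rw [← Nat.div_add_mod ((n₁ + N).toNat) s, ← Nat.div_add_mod ((n₂ + N).toNat) s, hmod]
      simp only at heq
      rw [heq]
    have : (n₁ + N : ℤ) = n₂ + N := by rw [← e₁, ← e₂, this]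
    linarith
  have hcard : F.card ≤ (Finset.range (2 * N / s + 1)).card := by
    refine Finset.card_le_card_of_injOn (fun n : ℤ => (n + N).toNat / s) (fun n hn => ?_) hinj
    have := (hmap n (Finset.mem_coe.mp hn)).2
    rw [Finset.mem_coe, Finset.mem_range]
    exact Nat.lt_succ_of_le (Nat.div_le_div_right this)
  rw [Finset.card_range] at hcard
  have h1 : ((F.card : ℕ) : ℝ) ≤ ((2 * N / s + 1 : ℕ) : ℝ) := by exact_mod_cast hcard
  refine h1.trans ?_
  push_cast
  have : ((2 * N / s : ℕ) : ℝ) ≤ 2 * (N : ℝ) / s := by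
    rw [le_div_iff₀ hsR]
    have := Nat.div_mul_le_self (2 * N) s
    exact_mod_cast this
  linarith

/-! ### Sums of squares of fibre cardinalities -/

/-- `∑_b #{a ∈ S : f a = b}² = #{(a, a') ∈ S² : f a = f a'}` when `f(S) ⊆ T`. [folklore] -/
theorem sum_sq_card_filter_eq {α β : Type*} [DecidableEq α] [DecidableEq β] (S : Finset α)
    (T : Finset β) (f : α → β) (hf : ∀ a ∈ S, f a ∈ T) :
    ∑ b ∈ T, ((S.filter (fun a => f a = b)).card) ^ 2 =
      ((S ×ˢ S).filter (fun x : α × α => f x.1 = f x.2)).card := by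
  rw [Finset.card_eq_sum_card_fiberwise (f := fun x : α × α => f x.1) (t := T)
    (fun x hx => by
      rw [Finset.mem_coe, Finset.mem_filter, Finset.mem_product] at hx
      exact Finset.mem_coe.mpr (hf _ hx.1.1))]
  refine Finset.sum_congr rfl fun b _ => ?_
  rw [Finset.filter_filter]
  have : (S ×ˢ S).filter (fun x : α × α => f x.1 = f x.2 ∧ f x.1 = b) =
      (S.filter (fun a => f a = b)) ×ˢ (S.filter (fun a => f a = b)) := by
    ext x
    simp only [Finset.mem_filter, Finset.mem_product]
    constructor
    · rintro ⟨⟨h1, h2⟩, h3, h4⟩; exact ⟨⟨h1, h4⟩, h2, by rw [← h3, h4]⟩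
    · rintro ⟨⟨h1, h2⟩, h3, h4⟩; exact ⟨⟨h1, h3⟩, by rw [h2, h4], h2⟩
  rw [this, Finset.card_product, sq]

/-! ### Dyadic blocks of `t` according to `d0 t` -/

/-- The block `2^j ≤ d0 t < 2^{j+1}` (`t ≠ 0`). [folklore] -/
def blk (s : ℕ) (j : ℕ) : Finset (ZMod s) := by
  classical
  exact if h : s = 0 then ∅ else
    (@Finset.univ (ZMod s) (@ZMod.fintype s ⟨h⟩)).filter (fun t => t ≠ 0 ∧ 2 ^ j ≤ d0 t ∧ d0 t < 2 ^ (j + 1))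

/-- Membership in a block. [folklore] -/
theorem mem_blk {s : ℕ} [NeZero s] {j : ℕ} {t : ZMod s} :
    t ∈ blk s j ↔ t ≠ 0 ∧ 2 ^ j ≤ d0 t ∧ d0 t < 2 ^ (j + 1) := by
  classical
  unfold blk
  rw [dif_neg (NeZero.ne s)]
  simp only [Finset.mem_filter, Finset.mem_univ, true_and]

/-- `#blk_j ≤ 2^{j+2}`. [folklore] -/
theorem card_blk_le {s : ℕ} [NeZero s] (j : ℕ) : (blk s j).card ≤ 2 ^ (j + 2) := by
  classical
  calc (blk s j).card ≤ ((Finset.univ : Finset (ZMod s)).filter (fun t => d0 t < 2 ^ (j + 1))).card := by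
        refine Finset.card_le_card fun t ht => ?_
        rw [Finset.mem_filter]
        exact ⟨Finset.mem_univ _, (mem_blk.mp ht).2.2⟩
    _ ≤ 2 * 2 ^ (j + 1) := card_filter_d0_lt_le _
    _ = 2 ^ (j + 2) := by ring

/-- Every `t ≠ 0` lies in the block `j = log₂ (d0 t) ≤ log₂ s`. [folklore] -/
theorem mem_blk_log {s : ℕ} [NeZero s] {t : ZMod s} (ht : t ≠ 0) : t ∈ blk s (Nat.log 2 (d0 t)) := by
  rw [mem_blk]
  refine ⟨ht, Nat.pow_log_le_self 2 (d0_pos ht).ne', Nat.lt_pow_succ_log_self (by norm_num) _⟩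

/-- … and in no other block. [folklore] -/
theorem log_eq_of_mem_blk {s : ℕ} [NeZero s] {j : ℕ} {t : ZMod s} (ht : t ∈ blk s j) :
    Nat.log 2 (d0 t) = j := by
  rw [mem_blk] at ht
  exact Nat.log_eq_of_pow_le_of_lt_pow ht.2.1 ht.2.2

/-- The block index is at most `log₂ s`. [folklore] -/
theorem log_d0_le {s : ℕ} [NeZero s] (t : ZMod s) : Nat.log 2 (d0 t) ≤ Nat.log 2 s :=
  Nat.log_mono_right (d0_le t)

/-! ### (6.4): counting `t₁u₂ ≡ t₂u₁ (mod s)` in a block -/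

/-- **Heath-Brown's count for (6.4).** For `u`'s in `[1, R]` and `t₁, t₂` in the block `blk_j`, the
solutions of `t₁u₂ ≡ t₂u₁ (mod s)` number at most `#U · #blk_j · (2^{j+2}R/s + 2) · M`, where
`M ≥ d(n)` for `0 < n ≤ 2^{j+1}R`: for fixed `(t₂, u₁)` the integer `n = t̃₁u₂` (`t̃₁` the centred
representative, `|t̃₁| < 2^{j+1}`) is `≠ 0`, lies in `[−2^{j+1}R, 2^{j+1}R]` and in the class `t₂u₁ mod s`,
and each such `n` has at most `d(|n|)` factorizations ("There are `O(TI)` pairs `(t₂, u₁)`. Moreover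
the number of integers `n` for which `n ≡ t₂u₁ (mod q)` and `TU < |n| ≤ 2TζU` is `O(1 + TUq⁻¹)`; and
for each such `n` there are `O(X^ε)` solutions `t₁u₂ = n`", p. 45–46). [cite: HeathBrown1986d3, §6 (6.4)] -/
theorem card_sol_blk_le {s : ℕ} [NeZero s] {Ubox : Finset ℕ} {R : ℕ}
    (hU : ∀ u ∈ Ubox, 1 ≤ u ∧ u ≤ R) (j : ℕ) {M : ℝ} (hM0 : 0 ≤ M)
    (hM : ∀ n : ℕ, n ≠ 0 → n ≤ 2 ^ (j + 1) * R → (n.divisors.card : ℝ) ≤ M) :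
    (((((Ubox ×ˢ blk s j) ×ˢ (Ubox ×ˢ blk s j)).filter
        (fun x : (ℕ × ZMod s) × (ℕ × ZMod s) =>
          x.1.2 * (x.2.1 : ZMod s) = x.2.2 * (x.1.1 : ZMod s))).card : ℕ) : ℝ) ≤
      Ubox.card * (blk s j).card * ((2 * ((2 ^ (j + 1) * R : ℕ) : ℝ) / s + 2) * M) := by
  classical
  have hs : 0 < s := Nat.pos_of_ne_zero (NeZero.ne s)
  set B := blk s j with hB
  set N : ℕ := 2 ^ (j + 1) * R with hN
  set Sol := ((Ubox ×ˢ B) ×ˢ (Ubox ×ˢ B)).filter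
      (fun x : (ℕ × ZMod s) × (ℕ × ZMod s) => x.1.2 * (x.2.1 : ZMod s) = x.2.2 * (x.1.1 : ZMod s))
    with hSol
  set ψ : (ℕ × ZMod s) × (ℕ × ZMod s) → ℕ × ZMod s := fun x => (x.1.1, x.2.2) with hψ
  have hmaps : Set.MapsTo ψ (Sol : Set ((ℕ × ZMod s) × (ℕ × ZMod s))) ((Ubox ×ˢ B : Finset _) : Set _) := by
    intro x hx
    rw [Finset.mem_coe, hSol, Finset.mem_filter, Finset.mem_product, Finset.mem_product,
      Finset.mem_product] at hx
    rw [Finset.mem_coe, Finset.mem_product]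
    exact ⟨hx.1.1.1, hx.1.2.2⟩
  have hbnd0 : 0 ≤ (2 * (N : ℝ) / s + 2) * M := by positivity
  -- each fibre over `c = (u₁, t₂)`
  have hfib : ∀ c ∈ Ubox ×ˢ B,
      (((Sol.filter (fun x => ψ x = c)).card : ℕ) : ℝ) ≤ (2 * (N : ℝ) / s + 2) * M := by
    intro c hc
    set Fc := Sol.filter (fun x => ψ x = c) with hFc
    set nf : (ℕ × ZMod s) × (ℕ × ZMod s) → ℤ := fun x => crep x.1.2 * (x.2.1 : ℤ) with hnf
    set Nset := (Finset.Icc (-(N : ℤ)) N).filter (fun n : ℤ => (n : ZMod s) = c.2 * (c.1 : ZMod s))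
      with hNset
    -- the data of a member of the fibre
    have hmem : ∀ x ∈ Fc, x.1.1 ∈ Ubox ∧ x.1.2 ∈ B ∧ x.2.1 ∈ Ubox ∧ x.2.2 ∈ B ∧
        x.1.2 * (x.2.1 : ZMod s) = x.2.2 * (x.1.1 : ZMod s) ∧ x.1.1 = c.1 ∧ x.2.2 = c.2 := by
      intro x hx
      rw [hFc, Finset.mem_filter, hSol, Finset.mem_filter, Finset.mem_product, Finset.mem_product,
        Finset.mem_product] at hx
      obtain ⟨⟨⟨⟨h1, h2⟩, h3, h4⟩, h5⟩, h6⟩ := hx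
      have h6' : (x.1.1, x.2.2) = (c.1, c.2) := h6
      rw [Prod.mk.injEq] at h6'
      exact ⟨h1, h2, h3, h4, h5, h6'.1, h6'.2⟩
    have hmaps2 : Set.MapsTo nf (Fc : Set _) (Nset : Set ℤ) := by
      intro x hx
      obtain ⟨_, ht₁, hu₂, _, heq, hu₁c, ht₂c⟩ := hmem x (Finset.mem_coe.mp hx)
      have hd : d0 x.1.2 < 2 ^ (j + 1) := (mem_blk.mp ht₁).2.2
      have hu₂' := hU _ hu₂
      rw [Finset.mem_coe, hNset, Finset.mem_filter, Finset.mem_Icc]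
      have habs : (nf x).natAbs ≤ N := by
        simp only [hnf]
        rw [Int.natAbs_mul, Int.natAbs_natCast, natAbs_crep, hN]
        exact Nat.mul_le_mul hd.le hu₂'.2
      refine ⟨⟨?_, ?_⟩, ?_⟩
      · have := (abs_le.mp (le_of_eq (Int.abs_eq_natAbs (nf x)))).1; omega
      · have := Int.le_natAbs (a := nf x); omega
      · simp only [hnf]
        push_cast
        rw [crep_cast, heq, ht₂c, hu₁c]
    rw [Finset.card_eq_sum_card_fiberwise hmaps2]
    have hfib2 : ∀ n ∈ Nset, (((Fc.filter (fun x => nf x = n)).card : ℕ) : ℝ) ≤ M := by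
      intro n _
      rcases (Fc.filter (fun x => nf x = n)).eq_empty_or_nonempty with he | hne
      · rw [he, Finset.card_empty, Nat.cast_zero]; exact hM0
      · obtain ⟨x₀, hx₀⟩ := hne
        rw [Finset.mem_filter] at hx₀
        obtain ⟨_, ht₁, hu₂, _, _, _, _⟩ := hmem x₀ hx₀.1
        have hn0 : n ≠ 0 := by
          rw [← hx₀.2]
          simp only [hnf]
          exact mul_ne_zero (crep_ne_zero (mem_blk.mp ht₁).1)
            (by exact_mod_cast (Nat.one_le_iff_ne_zero.mp (hU _ hu₂).1))
        have hnN : n.natAbs ≤ N := by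
          rw [← hx₀.2]
          simp only [hnf]
          rw [Int.natAbs_mul, Int.natAbs_natCast, natAbs_crep, hN]
          exact Nat.mul_le_mul (mem_blk.mp ht₁).2.2.le (hU _ hu₂).2
        -- inject the `n`-fibre into the divisors of `|n|` via `u₂`
        have hcard : (Fc.filter (fun x => nf x = n)).card ≤ n.natAbs.divisors.card := by
          refine Finset.card_le_card_of_injOn (fun x => x.2.1) (fun x hx => ?_) ?_
          · rw [Finset.mem_coe, Finset.mem_filter] at hx
            rw [Finset.mem_coe, Nat.mem_divisors]
            refine ⟨?_, Int.natAbs_ne_zero.mpr hn0⟩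
            rw [← hx.2]
            simp only [hnf]
            rw [Int.natAbs_mul, Int.natAbs_natCast]
            exact Dvd.intro_left _ rfl
          · intro x hx x' hx' heq
            rw [Finset.mem_coe, Finset.mem_filter] at hx hx'
            obtain ⟨_, _, hu₂, _, _, hu₁c, ht₂c⟩ := hmem x hx.1
            obtain ⟨_, _, _, _, _, hu₁c', ht₂c'⟩ := hmem x' hx'.1
            simp only at heq
            have hu₂0 : (x.2.1 : ℤ) ≠ 0 := by
              exact_mod_cast (Nat.one_le_iff_ne_zero.mp (hU _ hu₂).1)
            have hcrep : crep x.1.2 = crep x'.1.2 := by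
              have := hx.2.trans hx'.2.symm
              simp only [hnf] at this
              rw [← heq] at this
              exact mul_right_cancel₀ hu₂0 this
            have ht₁ : x.1.2 = x'.1.2 := by
              rw [← crep_cast x.1.2, ← crep_cast x'.1.2, hcrep]
            exact Prod.ext (Prod.ext (hu₁c.trans hu₁c'.symm) ht₁) (Prod.ext heq (ht₂c.trans ht₂c'.symm))
        calc (((Fc.filter (fun x => nf x = n)).card : ℕ) : ℝ) ≤ (n.natAbs.divisors.card : ℝ) := by
              exact_mod_cast hcard
          _ ≤ M := hM _ (Int.natAbs_ne_zero.mpr hn0) hnN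
    push_cast
    calc ∑ n ∈ Nset, (((Fc.filter (fun x => nf x = n)).card : ℕ) : ℝ) ≤ ∑ _n ∈ Nset, M :=
          Finset.sum_le_sum hfib2
      _ = (Nset.card : ℝ) * M := by rw [Finset.sum_const, nsmul_eq_mul]
      _ ≤ (2 * (N : ℝ) / s + 2) * M := by
          apply mul_le_mul_of_nonneg_right _ hM0
          exact card_Icc_filter_intCast_eq_le hs N _
  rw [Finset.card_eq_sum_card_fiberwise hmaps]
  push_cast
  calc ∑ c ∈ Ubox ×ˢ B, (((Sol.filter (fun x => ψ x = c)).card : ℕ) : ℝ)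
      ≤ ∑ _c ∈ Ubox ×ˢ B, (2 * (N : ℝ) / s + 2) * M := Finset.sum_le_sum hfib
    _ = Ubox.card * B.card * ((2 * (N : ℝ) / s + 2) * M) := by
        rw [Finset.sum_const, nsmul_eq_mul, Finset.card_product]; push_cast; ring

/-- The weight bound on a block: `w(t) ≤ g_j = min(K', s/2^{j+1})` for `t ∈ blk_j`. [folklore] -/
theorem weight_le_of_mem_blk {s : ℕ} [NeZero s] {w : ZMod s → ℝ} {K' : ℝ} (hwK : ∀ t, w t ≤ K')
    (hws : ∀ t, t ≠ 0 → w t * (2 * d0 t) ≤ s) {j : ℕ} {t : ZMod s} (ht : t ∈ blk s j) :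
    w t ≤ min K' ((s : ℝ) / 2 ^ (j + 1)) := by
  obtain ⟨ht0, hlo, _⟩ := mem_blk.mp ht
  refine le_min (hwK t) ?_
  rw [le_div_iff₀ (by positivity)]
  have h1 := hws t ht0
  have h2 : (2 : ℝ) ^ (j + 1) ≤ 2 * (d0 t : ℝ) := by
    rw [pow_succ]
    have : ((2 ^ j : ℕ) : ℝ) ≤ d0 t := by exact_mod_cast hlo
    push_cast at this; linarith
  rcases le_or_gt 0 (w t) with hw | hw
  · calc w t * 2 ^ (j + 1) ≤ w t * (2 * (d0 t : ℝ)) := by gcongr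
      _ ≤ s := h1
  · have : w t * (2 : ℝ) ^ (j + 1) ≤ 0 := mul_nonpos_of_nonpos_of_nonneg hw.le (by positivity)
    have : (0 : ℝ) ≤ s := Nat.cast_nonneg _
    linarith

/-- The per-block numerics: `g_j² · #blk_j · (2^{j+2}R/s + 2) ≤ 4s(R + K')`. [folklore] -/
theorem gj_sq_mul_le {s : ℕ} [NeZero s] {K' : ℝ} (hK' : 0 ≤ K') (R j : ℕ) :
    (min K' ((s : ℝ) / 2 ^ (j + 1))) ^ 2 * ((blk s j).card : ℝ) *
        (2 * ((2 ^ (j + 1) * R : ℕ) : ℝ) / s + 2) ≤ 4 * s * (R + K') := by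
  have hs : 0 < s := Nat.pos_of_ne_zero (NeZero.ne s)
  have hsR : (0 : ℝ) < s := by exact_mod_cast hs
  set g : ℝ := min K' ((s : ℝ) / 2 ^ (j + 1)) with hg
  have hg0 : 0 ≤ g := le_min hK' (by positivity)
  have hgK : g ≤ K' := min_le_left _ _
  have hgs : g ≤ (s : ℝ) / 2 ^ (j + 1) := min_le_right _ _
  have hP : (0 : ℝ) < 2 ^ (j + 1) := by positivity
  have hcard : ((blk s j).card : ℝ) ≤ 2 ^ (j + 2) := by exact_mod_cast card_blk_le (s := s) j
  -- `g² 2^{j+2} · 2^{j+2}R/s ≤ 4 s R` and `g² 2^{j+2} · 2 ≤ 4 s K'`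
  have e1 : g * 2 ^ (j + 1) ≤ s := by rwa [le_div_iff₀ hP] at hgs
  have h1 : g ^ 2 * 2 ^ (j + 2) * (2 * ((2 ^ (j + 1) * R : ℕ) : ℝ) / s) ≤ 4 * s * R := by
    have : g ^ 2 * 2 ^ (j + 2) * (2 * ((2 ^ (j + 1) * R : ℕ) : ℝ) / s) =
        4 * (g * 2 ^ (j + 1)) ^ 2 * R / s := by
      push_cast; field_simp; ring
    rw [this, div_le_iff₀ hsR]
    have hR : (0 : ℝ) ≤ R := Nat.cast_nonneg _
    have : (g * 2 ^ (j + 1)) ^ 2 ≤ (s : ℝ) ^ 2 := by gcongr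
    nlinarith
  have h2 : g ^ 2 * 2 ^ (j + 2) * 2 ≤ 4 * s * K' := by
    have : g ^ 2 * 2 ^ (j + 2) * 2 = 4 * (g * (g * 2 ^ (j + 1))) := by ring
    rw [this]
    have : g * (g * 2 ^ (j + 1)) ≤ K' * s := mul_le_mul hgK e1 (by positivity) hK'
    linarith
  calc g ^ 2 * ((blk s j).card : ℝ) * (2 * ((2 ^ (j + 1) * R : ℕ) : ℝ) / s + 2)
      ≤ g ^ 2 * 2 ^ (j + 2) * (2 * ((2 ^ (j + 1) * R : ℕ) : ℝ) / s + 2) := by gcongr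
    _ = g ^ 2 * 2 ^ (j + 2) * (2 * ((2 ^ (j + 1) * R : ℕ) : ℝ) / s) + g ^ 2 * 2 ^ (j + 2) * 2 := by ring
    _ ≤ 4 * s * R + 4 * s * K' := add_le_add h1 h2
    _ = 4 * s * (R + K') := by ring

/-- **(6.4)**: `∑_k n(k)² ≤ 4(log₂ s + 1)² M s #U (R + K')` for
`n(k) = ∑_{u ∈ U, t ≠ 0, a'tū = k} w(t)`, weights `0 ≤ w(t) ≤ min(K', s/(2 d0 t))`, `u`'s units in
`[1, R]`, `M ≥ d(n)` (`0 < n ≤ 2sR`) ("we shift the range of `t` … so that `0 < |t| ≤ q/2`. We then split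
up this new range into intervals `T < |t| ≤ 2T` … `n(k, T) ≪ min(K, qT⁻¹)#{(u, t) …}` … by Cauchy's
inequality … `∑ n(k)² ≪ X^ε (log q)² (qIK + qUI)`", p. 45–46). [cite: HeathBrown1986d3, §6 (6.4)] -/
theorem sum_sq_nk_le {s : ℕ} [NeZero s] {a' : ZMod s} (ha' : IsUnit a') {Ubox : Finset ℕ} {R : ℕ}
    (hU : ∀ u ∈ Ubox, 1 ≤ u ∧ u ≤ R) (hUu : ∀ u ∈ Ubox, IsUnit (u : ZMod s))
    {w : ZMod s → ℝ} {K' : ℝ} (hK' : 0 ≤ K') (hw0 : ∀ t, 0 ≤ w t) (hwK : ∀ t, w t ≤ K')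
    (hws : ∀ t, t ≠ 0 → w t * (2 * d0 t) ≤ s)
    {M : ℝ} (hM0 : 0 ≤ M) (hM : ∀ n : ℕ, n ≠ 0 → n ≤ 2 * s * R → (n.divisors.card : ℝ) ≤ M) :
    ∑ k : ZMod s, (∑ p ∈ (Ubox ×ˢ (Finset.univ.erase (0 : ZMod s))).filter
        (fun p : ℕ × ZMod s => a' * p.2 * ((p.1 : ZMod s))⁻¹ = k), w p.2) ^ 2 ≤
      4 * ((Nat.log 2 s : ℝ) + 1) ^ 2 * M * s * Ubox.card * (R + K') := by
  classical
  have hs : 0 < s := Nat.pos_of_ne_zero (NeZero.ne s)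
  have hsR : (0 : ℝ) < s := by exact_mod_cast hs
  set Lg := Nat.log 2 s with hLg
  set Jr := Finset.range (Lg + 1) with hJr
  set key : ℕ × ZMod s → ZMod s := fun p => a' * p.2 * ((p.1 : ZMod s))⁻¹ with hkey
  set g : ℕ → ℝ := fun j => min K' ((s : ℝ) / 2 ^ (j + 1)) with hg
  have hg0 : ∀ j, 0 ≤ g j := fun j => le_min hK' (by positivity)
  set c : ℕ → ZMod s → ℕ := fun j k => ((Ubox ×ˢ blk s j).filter (fun p => key p = k)).card with hc
  set nkj : ℕ → ZMod s → ℝ := fun j k =>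
    ∑ p ∈ (Ubox ×ˢ blk s j).filter (fun p => key p = k), w p.2 with hnkj
  -- Step 1: decomposition into blocks
  have hdecomp : ∀ k : ZMod s,
      ∑ p ∈ (Ubox ×ˢ (Finset.univ.erase (0 : ZMod s))).filter (fun p => key p = k), w p.2 =
        ∑ j ∈ Jr, nkj j k := by
    intro k
    set Sk := (Ubox ×ˢ (Finset.univ.erase (0 : ZMod s))).filter (fun p => key p = k) with hSk
    have hmaps : ∀ p ∈ Sk, Nat.log 2 (d0 p.2) ∈ Jr := fun p _ =>
      Finset.mem_range.mpr (Nat.lt_succ_of_le (log_d0_le p.2))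
    rw [← Finset.sum_fiberwise_of_maps_to hmaps]
    refine Finset.sum_congr rfl fun j _ => ?_
    simp only [hnkj]
    refine Finset.sum_congr ?_ fun _ _ => rfl
    ext p
    simp only [hSk, Finset.mem_filter, Finset.mem_product, Finset.mem_erase, Finset.mem_univ,
      and_true, mem_blk]
    constructor
    · rintro ⟨⟨⟨hu, ht0⟩, hk⟩, hj⟩
      have := mem_blk.mp (mem_blk_log ht0)
      rw [hj] at this
      exact ⟨⟨hu, this⟩, hk⟩
    · rintro ⟨⟨hu, hb⟩, hk⟩
      exact ⟨⟨⟨hu, hb.1⟩, hk⟩, Nat.log_eq_of_pow_le_of_lt_pow hb.2.1 hb.2.2⟩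
  -- Step 2: `0 ≤ nkj ≤ g_j c_j(k)`
  have hnkj0 : ∀ j k, 0 ≤ nkj j k := fun j k => Finset.sum_nonneg fun p _ => hw0 _
  have hnkj_le : ∀ j k, nkj j k ≤ g j * c j k := by
    intro j k
    simp only [hnkj, hc]
    calc ∑ p ∈ (Ubox ×ˢ blk s j).filter (fun p => key p = k), w p.2
        ≤ ∑ _p ∈ (Ubox ×ˢ blk s j).filter (fun p => key p = k), g j :=
          Finset.sum_le_sum fun p hp => by
            rw [Finset.mem_filter, Finset.mem_product] at hp
            exact weight_le_of_mem_blk hwK hws hp.1.2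
      _ = g j * _ := by rw [Finset.sum_const, nsmul_eq_mul, mul_comm]
  -- Step 3: Cauchy–Schwarz over the blocks
  have hCS : ∀ k : ZMod s, (∑ j ∈ Jr, nkj j k) ^ 2 ≤ (Lg + 1 : ℝ) * ∑ j ∈ Jr, (g j * c j k) ^ 2 := by
    intro k
    calc (∑ j ∈ Jr, nkj j k) ^ 2 ≤ Jr.card * ∑ j ∈ Jr, (nkj j k) ^ 2 := sq_sum_le_card_mul_sum_sq
      _ = (Lg + 1 : ℝ) * ∑ j ∈ Jr, (nkj j k) ^ 2 := by rw [hJr, Finset.card_range]; push_cast; ring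
      _ ≤ (Lg + 1 : ℝ) * ∑ j ∈ Jr, (g j * c j k) ^ 2 := by
          apply mul_le_mul_of_nonneg_left _ (by positivity)
          exact Finset.sum_le_sum fun j _ => pow_le_pow_left₀ (hnkj0 j k) (hnkj_le j k) 2
  -- Step 4: `∑_k c_j(k)² ≤` the block count
  have hcount : ∀ j ∈ Jr, ∑ k : ZMod s, ((c j k : ℕ) : ℝ) ^ 2 ≤
      Ubox.card * (blk s j).card * ((2 * ((2 ^ (j + 1) * R : ℕ) : ℝ) / s + 2) * M) := by
    intro j hj
    have hjL : j ≤ Lg := Nat.lt_succ_iff.mp (Finset.mem_range.mp hj)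
    have e := sum_sq_card_filter_eq (Ubox ×ˢ blk s j) Finset.univ key (fun _ _ => Finset.mem_univ _)
    have e' : ∑ k : ZMod s, ((c j k : ℕ) : ℝ) ^ 2 =
        ((((Ubox ×ˢ blk s j) ×ˢ (Ubox ×ˢ blk s j)).filter
          (fun x => key x.1 = key x.2)).card : ℝ) := by
      simp only [hc]; exact_mod_cast e
    rw [e']
    have hsub : ((Ubox ×ˢ blk s j) ×ˢ (Ubox ×ˢ blk s j)).filter (fun x => key x.1 = key x.2) ⊆
        ((Ubox ×ˢ blk s j) ×ˢ (Ubox ×ˢ blk s j)).filter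
          (fun x : (ℕ × ZMod s) × (ℕ × ZMod s) =>
            x.1.2 * (x.2.1 : ZMod s) = x.2.2 * (x.1.1 : ZMod s)) := by
      intro x hx
      rw [Finset.mem_filter, Finset.mem_product, Finset.mem_product, Finset.mem_product] at hx ⊢
      refine ⟨hx.1, ?_⟩
      obtain ⟨⟨⟨hu₁, _⟩, hu₂, _⟩, hk⟩ := hx
      simp only [hkey] at hk
      have h1 := hUu _ hu₁
      have h2 := hUu _ hu₂
      -- cancel `a'` and clear the inverses
      have hk' : x.1.2 * ((x.1.1 : ZMod s))⁻¹ = x.2.2 * ((x.2.1 : ZMod s))⁻¹ := by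
        have := congr_arg (fun z => a'⁻¹ * z) hk
        rwa [← mul_assoc, ← mul_assoc, ← mul_assoc, ← mul_assoc, ZMod.inv_mul_of_unit _ ha',
          one_mul, one_mul] at this
      calc x.1.2 * (x.2.1 : ZMod s) = x.1.2 * ((x.1.1 : ZMod s))⁻¹ * (x.1.1 : ZMod s) * (x.2.1 : ZMod s) := by
            rw [mul_assoc x.1.2, ZMod.inv_mul_of_unit _ h1, mul_one]
        _ = x.2.2 * ((x.2.1 : ZMod s))⁻¹ * (x.1.1 : ZMod s) * (x.2.1 : ZMod s) := by rw [hk']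
        _ = x.2.2 * (x.1.1 : ZMod s) * (((x.2.1 : ZMod s))⁻¹ * (x.2.1 : ZMod s)) := by ring
        _ = x.2.2 * (x.1.1 : ZMod s) := by rw [ZMod.inv_mul_of_unit _ h2, mul_one]
    have hM' : ∀ n : ℕ, n ≠ 0 → n ≤ 2 ^ (j + 1) * R → (n.divisors.card : ℝ) ≤ M := by
      intro n hn hle
      refine hM n hn (hle.trans ?_)
      have : 2 ^ (j + 1) ≤ 2 * s := by
        rw [pow_succ]
        have := (Nat.pow_le_pow_right (by norm_num) hjL).trans (Nat.pow_log_le_self 2 hs.ne')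
        linarith
      exact Nat.mul_le_mul_right _ this
    calc ((((Ubox ×ˢ blk s j) ×ˢ (Ubox ×ˢ blk s j)).filter (fun x => key x.1 = key x.2)).card : ℝ)
        ≤ ((((Ubox ×ˢ blk s j) ×ˢ (Ubox ×ˢ blk s j)).filter
            (fun x : (ℕ × ZMod s) × (ℕ × ZMod s) =>
              x.1.2 * (x.2.1 : ZMod s) = x.2.2 * (x.1.1 : ZMod s))).card : ℝ) := by
          exact_mod_cast Finset.card_le_card hsub
      _ ≤ _ := card_sol_blk_le hU j hM0 hM'
  -- Step 5: assemble
  calc ∑ k : ZMod s, (∑ p ∈ (Ubox ×ˢ (Finset.univ.erase (0 : ZMod s))).filter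
          (fun p => key p = k), w p.2) ^ 2
      = ∑ k : ZMod s, (∑ j ∈ Jr, nkj j k) ^ 2 := by
        refine Finset.sum_congr rfl fun k _ => ?_; rw [hdecomp k]
    _ ≤ ∑ k : ZMod s, (Lg + 1 : ℝ) * ∑ j ∈ Jr, (g j * c j k) ^ 2 := Finset.sum_le_sum fun k _ => hCS k
    _ = (Lg + 1 : ℝ) * ∑ j ∈ Jr, (g j) ^ 2 * ∑ k : ZMod s, ((c j k : ℕ) : ℝ) ^ 2 := by
        rw [← Finset.mul_sum, Finset.sum_comm]
        congr 1
        refine Finset.sum_congr rfl fun j _ => ?_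
        rw [Finset.mul_sum]
        refine Finset.sum_congr rfl fun k _ => ?_
        ring
    _ ≤ (Lg + 1 : ℝ) * ∑ j ∈ Jr, (g j) ^ 2 *
          (Ubox.card * (blk s j).card * ((2 * ((2 ^ (j + 1) * R : ℕ) : ℝ) / s + 2) * M)) := by
        gcongr with j hj
        exact hcount j hj
    _ = (Lg + 1 : ℝ) * ∑ j ∈ Jr, (Ubox.card * M) *
          ((g j) ^ 2 * ((blk s j).card : ℝ) * (2 * ((2 ^ (j + 1) * R : ℕ) : ℝ) / s + 2)) := by
        congr 1; refine Finset.sum_congr rfl fun j _ => ?_; ring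
    _ ≤ (Lg + 1 : ℝ) * ∑ _j ∈ Jr, (Ubox.card * M) * (4 * s * (R + K')) := by
        apply mul_le_mul_of_nonneg_left _ (by positivity)
        exact Finset.sum_le_sum fun j _ => mul_le_mul_of_nonneg_left (gj_sq_mul_le hK' R j) (by positivity)
    _ = 4 * ((Nat.log 2 s : ℝ) + 1) ^ 2 * M * s * Ubox.card * (R + K') := by
        rw [Finset.sum_const, hJr, Finset.card_range, nsmul_eq_mul]; push_cast; ring



/-! ### Orthogonality and Plancherel on `ℤ/sℤ` -/

/-- Orthogonality: `∑_k e_s(t k) = s [t = 0]`. [folklore] -/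
theorem sum_stdAddChar_mul (s : ℕ) [NeZero s] (t : ZMod s) :
    ∑ k : ZMod s, (ZMod.stdAddChar (t * k) : ℂ) = if t = 0 then (s : ℂ) else 0 := by
  split_ifs with h
  · simp only [h, zero_mul, AddChar.map_zero_eq_one, sum_const, card_univ, ZMod.card,
      nsmul_eq_mul, mul_one]
  · exact AddChar.sum_eq_zero_of_ne_one (ZMod.isPrimitive_stdAddChar s h)

/-- **Plancherel on `ℤ/sℤ`**: `∑_k |∑_σ c(σ) e_s(kσ)|² = s ∑_σ |c(σ)|²`. [folklore] -/
theorem sum_norm_sq_fourier (s : ℕ) [NeZero s] (c : ZMod s → ℂ) :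
    ∑ k : ZMod s, ‖∑ σ : ZMod s, c σ * (ZMod.stdAddChar (k * σ) : ℂ)‖ ^ 2 =
      s * ∑ σ : ZMod s, ‖c σ‖ ^ 2 := by
  classical
  set ψ : AddChar (ZMod s) ℂ := ZMod.stdAddChar with hψ
  have hchar : 0 < ringChar (ZMod s) := by
    rw [ZMod.ringChar_zmod_n]; exact Nat.pos_of_ne_zero (NeZero.ne s)
  -- in `ℂ`
  have hC : ∀ k : ZMod s, ((‖∑ σ : ZMod s, c σ * ψ (k * σ)‖ ^ 2 : ℝ) : ℂ) =
      ∑ σ : ZMod s, ∑ σ' : ZMod s, (starRingEnd ℂ (c σ) * c σ') * ψ (k * (σ' - σ)) := by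
    intro k
    rw [← Complex.normSq_eq_norm_sq, Complex.normSq_eq_conj_mul_self, map_sum, Finset.sum_mul]
    refine Finset.sum_congr rfl fun σ _ => ?_
    rw [Finset.mul_sum]
    refine Finset.sum_congr rfl fun σ' _ => ?_
    rw [map_mul, AddChar.starComp_apply hchar, AddChar.inv_apply]
    have : ψ (-(k * σ)) * ψ (k * σ') = ψ (k * (σ' - σ)) := by
      rw [← AddChar.map_add_eq_mul]; congr 1; ring
    calc starRingEnd ℂ (c σ) * ψ (-(k * σ)) * (c σ' * ψ (k * σ'))
        = starRingEnd ℂ (c σ) * c σ' * (ψ (-(k * σ)) * ψ (k * σ')) := by ring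
      _ = _ := by rw [this]
  have hsum : (∑ k : ZMod s, ((‖∑ σ : ZMod s, c σ * ψ (k * σ)‖ ^ 2 : ℝ) : ℂ)) =
      (s : ℂ) * ∑ σ : ZMod s, ((‖c σ‖ ^ 2 : ℝ) : ℂ) := by
    simp_rw [hC]
    rw [Finset.sum_comm]
    rw [Finset.mul_sum]
    refine Finset.sum_congr rfl fun σ _ => ?_
    rw [Finset.sum_comm]
    have inner : ∀ σ' : ZMod s, ∑ k : ZMod s, (starRingEnd ℂ (c σ) * c σ') * ψ (k * (σ' - σ)) =
        if σ' = σ then (s : ℂ) * (starRingEnd ℂ (c σ) * c σ) else 0 := by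
      intro σ'
      rw [← Finset.mul_sum]
      have := sum_stdAddChar_mul s (σ' - σ)
      have e : ∑ k : ZMod s, ψ (k * (σ' - σ)) = ∑ k : ZMod s, ψ ((σ' - σ) * k) := by
        refine Finset.sum_congr rfl fun k _ => ?_; rw [mul_comm]
      rw [e, hψ, this]
      split_ifs with h1 h2 h2
      · rw [sub_eq_zero.mp h1]; ring
      · exact absurd (sub_eq_zero.mp h1) h2
      · exact absurd (sub_eq_zero.mpr h2) h1
      · ring
    rw [Finset.sum_congr rfl (fun σ' _ => inner σ'), Finset.sum_ite_eq' Finset.univ σ, if_pos (Finset.mem_univ _)]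
    rw [← Complex.normSq_eq_conj_mul_self, Complex.normSq_eq_norm_sq]
  exact_mod_cast hsum

/-! ### (6.5): the fourth moment of `∑_v e_s(k v̄)` is `s · H(𝒥, s)` -/

/-- `(∑_{v ∈ 𝒥*} e_s(k v̄))² = ∑_σ m(σ) e_s(kσ)`. [cite: HeathBrown1986d3, §6 (6.5)–(6.6)] -/
theorem sq_sum_stdAddChar_inv_eq (s : ℕ) [NeZero s] (S : Finset ℕ) (k : ZMod s) :
    (∑ v ∈ unitsIn s S, (ZMod.stdAddChar (k * ((v : ZMod s))⁻¹) : ℂ)) ^ 2 =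
      ∑ σ : ZMod s, (invPairCount s S σ : ℂ) * (ZMod.stdAddChar (k * σ) : ℂ) := by
  classical
  set ψ : AddChar (ZMod s) ℂ := ZMod.stdAddChar with hψ
  set T := unitsIn s S with hT
  set f : ℕ × ℕ → ZMod s := fun p => ((p.1 : ZMod s))⁻¹ + ((p.2 : ZMod s))⁻¹ with hf
  have h1 : (∑ v ∈ T, ψ (k * ((v : ZMod s))⁻¹)) ^ 2 = ∑ p ∈ T ×ˢ T, ψ (k * f p) := by
    rw [sq, Finset.sum_mul_sum, Finset.sum_product]
    refine Finset.sum_congr rfl fun v₁ _ => Finset.sum_congr rfl fun v₂ _ => ?_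
    rw [← AddChar.map_add_eq_mul]; congr 1; simp only [hf]; ring
  rw [h1, ← Finset.sum_fiberwise_of_maps_to (g := f) (t := Finset.univ) (fun p _ => Finset.mem_univ _)]
  refine Finset.sum_congr rfl fun σ _ => ?_
  have : ∀ p ∈ (T ×ˢ T).filter (fun p => f p = σ), ψ (k * f p) = ψ (k * σ) := by
    intro p hp; rw [(Finset.mem_filter.mp hp).2]
  rw [Finset.sum_congr rfl this, Finset.sum_const, nsmul_eq_mul]
  rfl

/-- **(6.5)**: `∑_{k mod s} |∑_{v ∈ 𝒥, (v,s)=1} e_s(k v̄)|⁴ = s · H(𝒥, s)`.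
[cite: HeathBrown1986d3, §6 (6.5)] -/
theorem sum_norm_pow_four_eq (s : ℕ) [NeZero s] (S : Finset ℕ) :
    ∑ k : ZMod s, ‖∑ v ∈ unitsIn s S, (ZMod.stdAddChar (k * ((v : ZMod s))⁻¹) : ℂ)‖ ^ 4 =
      (s : ℝ) * (invEnergy s S : ℕ) := by
  classical
  have h : ∀ k : ZMod s, ‖∑ v ∈ unitsIn s S, (ZMod.stdAddChar (k * ((v : ZMod s))⁻¹) : ℂ)‖ ^ 4 =
      ‖∑ σ : ZMod s, (invPairCount s S σ : ℂ) * (ZMod.stdAddChar (k * σ) : ℂ)‖ ^ 2 := by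
    intro k
    rw [← sq_sum_stdAddChar_inv_eq, norm_pow]; ring
  simp_rw [h]
  rw [sum_norm_sq_fourier]
  unfold invEnergy
  push_cast
  congr 1
  refine Finset.sum_congr rfl fun σ _ => ?_
  rw [Complex.norm_natCast]

/-! ### (6.2): Hölder -/

/-- **(6.2), Hölder's inequality**: with `n(k) = ∑_{p : key p = k} w(p)`,
`(∑_p w(p) |S(key p)|)⁴ ≤ (∑_k n(k))² (∑_k n(k)²) (∑_k |S(k)|⁴)`. [cite: HeathBrown1986d3, §6 (6.2)] -/
theorem holder_main {s : ℕ} [NeZero s] {ι : Type*} (P : Finset ι) (w : ι → ℝ)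
    (hw0 : ∀ p ∈ P, 0 ≤ w p) (key : ι → ZMod s) (Sf : ZMod s → ℝ) (hS0 : ∀ k, 0 ≤ Sf k) :
    (∑ p ∈ P, w p * Sf (key p)) ^ 4 ≤
      (∑ k : ZMod s, ∑ p ∈ P.filter (fun p => key p = k), w p) ^ 2 *
        (∑ k : ZMod s, (∑ p ∈ P.filter (fun p => key p = k), w p) ^ 2) *
          ∑ k : ZMod s, Sf k ^ 4 := by
  classical
  set nk : ZMod s → ℝ := fun k => ∑ p ∈ P.filter (fun p => key p = k), w p with hnk
  have hnk0 : ∀ k, 0 ≤ nk k := fun k => Finset.sum_nonneg fun p hp => hw0 p (Finset.mem_filter.mp hp).1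
  -- collect according to `k`
  have h1 : ∑ p ∈ P, w p * Sf (key p) = ∑ k : ZMod s, nk k * Sf k := by
    rw [← Finset.sum_fiberwise_of_maps_to (g := key) (t := Finset.univ) (fun p _ => Finset.mem_univ _)]
    refine Finset.sum_congr rfl fun k _ => ?_
    rw [hnk, Finset.sum_mul]
    refine Finset.sum_congr rfl fun p hp => ?_
    rw [(Finset.mem_filter.mp hp).2]
  -- Cauchy–Schwarz twice
  have h2 : (∑ k : ZMod s, nk k * Sf k) ^ 2 ≤ (∑ k : ZMod s, nk k) * ∑ k : ZMod s, nk k * Sf k ^ 2 := by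
    have := Finset.sum_mul_sq_le_sq_mul_sq Finset.univ (fun k => Real.sqrt (nk k))
      (fun k => Real.sqrt (nk k) * Sf k)
    have e1 : ∀ k, Real.sqrt (nk k) * (Real.sqrt (nk k) * Sf k) = nk k * Sf k := by
      intro k; rw [← mul_assoc, Real.mul_self_sqrt (hnk0 k)]
    have e2 : ∀ k, Real.sqrt (nk k) ^ 2 = nk k := fun k => Real.sq_sqrt (hnk0 k)
    have e3 : ∀ k, (Real.sqrt (nk k) * Sf k) ^ 2 = nk k * Sf k ^ 2 := by
      intro k; rw [mul_pow, Real.sq_sqrt (hnk0 k)]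
    simp only [e1, e2, e3] at this
    exact this
  have h3 : (∑ k : ZMod s, nk k * Sf k ^ 2) ^ 2 ≤ (∑ k : ZMod s, nk k ^ 2) * ∑ k : ZMod s, Sf k ^ 4 := by
    have := Finset.sum_mul_sq_le_sq_mul_sq Finset.univ (fun k => nk k) (fun k => Sf k ^ 2)
    have e : ∀ k, (Sf k ^ 2) ^ 2 = Sf k ^ 4 := fun k => by ring
    simp only [e] at this
    exact this
  have hA0 : 0 ≤ ∑ k : ZMod s, nk k * Sf k := Finset.sum_nonneg fun k _ => mul_nonneg (hnk0 k) (hS0 k)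
  have hB0 : 0 ≤ ∑ k : ZMod s, nk k * Sf k ^ 2 :=
    Finset.sum_nonneg fun k _ => mul_nonneg (hnk0 k) (by positivity)
  have hN0 : 0 ≤ ∑ k : ZMod s, nk k := Finset.sum_nonneg fun k _ => hnk0 k
  rw [h1]
  calc (∑ k : ZMod s, nk k * Sf k) ^ 4 = ((∑ k : ZMod s, nk k * Sf k) ^ 2) ^ 2 := by ring
    _ ≤ ((∑ k : ZMod s, nk k) * ∑ k : ZMod s, nk k * Sf k ^ 2) ^ 2 := by gcongr
    _ = (∑ k : ZMod s, nk k) ^ 2 * (∑ k : ZMod s, nk k * Sf k ^ 2) ^ 2 := by ring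
    _ ≤ (∑ k : ZMod s, nk k) ^ 2 * ((∑ k : ZMod s, nk k ^ 2) * ∑ k : ZMod s, Sf k ^ 4) := by gcongr
    _ = _ := by ring

/-! ### (6.3): `∑_k n(k) = #U ∑_{t ≠ 0} w(t) ≤ #U · s(1 + log s)` -/

open Literature.NumberTheory.Sieve.Vinogradov (distInt distInt_nonneg) in
/-- `∑_{t ≠ 0} 1/(2‖t/s‖) ≤ s(1 + log s)` over `ℤ/sℤ`. [folklore] -/
theorem sum_inv_distInt_zmod_le (s : ℕ) [NeZero s] :
    ∑ t ∈ (Finset.univ : Finset (ZMod s)).erase 0, 1 / (2 * distInt (((t.val : ℕ) : ℝ) / s)) ≤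
      (s : ℝ) * (1 + Real.log s) := by
  classical
  have hs : 0 < s := Nat.pos_of_ne_zero (NeZero.ne s)
  have h0 : ∀ t : ZMod s, 0 ≤ 1 / (2 * distInt (((t.val : ℕ) : ℝ) / s)) := fun t =>
    div_nonneg zero_le_one (mul_nonneg zero_le_two (distInt_nonneg _))
  calc ∑ t ∈ (Finset.univ : Finset (ZMod s)).erase 0, 1 / (2 * distInt (((t.val : ℕ) : ℝ) / s))
      ≤ ∑ t : ZMod s, 1 / (2 * distInt (((t.val : ℕ) : ℝ) / s)) :=
        Finset.sum_le_sum_of_subset_of_nonneg (Finset.erase_subset _ _) fun t _ _ => h0 t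
    _ = ∑ j ∈ Finset.range s, 1 / (2 * distInt ((j : ℝ) / s)) := by
        refine Finset.sum_nbij (fun t : ZMod s => t.val) (fun t _ => Finset.mem_range.mpr (ZMod.val_lt t))
          (fun a _ b _ h => ZMod.val_injective s h) ?_ (fun t _ => rfl)
        intro j hj
        refine ⟨(j : ZMod s), Finset.mem_coe.mpr (Finset.mem_univ _), ?_⟩
        exact ZMod.val_natCast_of_lt (Finset.mem_range.mp hj)
    _ ≤ (s : ℝ) * (1 + Real.log s) := FouvryTenenbaum2021.lemma412_sum_range_inv_distInt_le hs

open Literature.NumberTheory.Sieve.Vinogradov (distInt distInt_nonneg) in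
/-- **(6.3)**: `∑_k n(k) = #U · ∑_{t≠0} w(t) ≤ #U · s(1 + log s)` when `w(t) ≤ 1/(2‖t/s‖)`.
[cite: HeathBrown1986d3, §6 (6.3)] -/
theorem sum_nk_le {s : ℕ} [NeZero s] (Ubox : Finset ℕ) (key : ℕ × ZMod s → ZMod s)
    {w : ZMod s → ℝ} (hw : ∀ t, t ≠ 0 → w t ≤ 1 / (2 * distInt (((t.val : ℕ) : ℝ) / s))) :
    ∑ k : ZMod s, ∑ p ∈ (Ubox ×ˢ (Finset.univ.erase (0 : ZMod s))).filter (fun p => key p = k), w p.2 ≤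
      Ubox.card * ((s : ℝ) * (1 + Real.log s)) := by
  classical
  rw [Finset.sum_fiberwise_of_maps_to (g := key) (t := Finset.univ) (fun p _ => Finset.mem_univ _),
    Finset.sum_product]
  calc ∑ u ∈ Ubox, ∑ t ∈ Finset.univ.erase (0 : ZMod s), w t
      ≤ ∑ _u ∈ Ubox, ∑ t ∈ Finset.univ.erase (0 : ZMod s), 1 / (2 * distInt (((t.val : ℕ) : ℝ) / s)) :=
        Finset.sum_le_sum fun u _ => Finset.sum_le_sum fun t ht => hw t (Finset.ne_of_mem_erase ht)
    _ ≤ ∑ _u ∈ Ubox, (s : ℝ) * (1 + Real.log s) :=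
        Finset.sum_le_sum fun u _ => sum_inv_distInt_zmod_le s
    _ = Ubox.card * ((s : ℝ) * (1 + Real.log s)) := by rw [Finset.sum_const, nsmul_eq_mul]

/-! ### The three-variable sum: Fourier expansion in `w` -/

open Literature.NumberTheory.LFunctions (kloostermanSum kloostermanSum_comm)
open Literature.NumberTheory.LFunctions.MatomakiMerikoski (norm_kloostermanSum_zero_left_le)
open Literature.NumberTheory.Sieve.Vinogradov (distInt distInt_nonneg)
open FouvryTenenbaum2021 (gAP lemma412_sum_gAP_eq_fourier lemma412_kloostermanSum_zero_zero
  lemma412_sum_filter_eq_sum_Ioc lemma412_norm_sum_Ioc_stdAddChar_le lemma412_gcd_val_mul_of_isUnit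
  lemma412_sum_gcd_div_distInt_le)

/-- `(xy)⁻¹ = x⁻¹ y⁻¹` for units of `ℤ/sℤ`. [folklore] -/
theorem mul_inv_of_isUnit {s : ℕ} [NeZero s] {x y : ZMod s} (hx : IsUnit x) (hy : IsUnit y) :
    (x * y)⁻¹ = x⁻¹ * y⁻¹ := by
  apply ZMod.inv_eq_of_mul_eq_one
  calc x * y * (x⁻¹ * y⁻¹) = (x * x⁻¹) * (y * y⁻¹) := by ring
    _ = 1 := by rw [ZMod.mul_inv_of_unit _ hx, ZMod.mul_inv_of_unit _ hy, one_mul]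

/-- The `u`-slice of the three-variable sum is a two-variable sum over `m₁ = uv ∈ u·B₂`:
`∑_{v,w} g_s(uvw; a) = s⁻¹ ∑_t E_u(t) F(t)` (from `lemma412_sum_gAP_eq_fourier`). [folklore] -/
theorem sum_gAP_three_eq_fourier {s : ℕ} [NeZero s] {a : ℤ} (ha : IsUnit (a : ZMod s))
    (B₁ B₂ B₃ : Finset ℕ) (hB₁ : ∀ u ∈ B₁, 1 ≤ u) :
    (((∑ u ∈ B₁, ∑ v ∈ B₂, ∑ w ∈ B₃, gAP s a (u * v * w) : ℝ)) : ℂ) =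
      (s : ℂ)⁻¹ * ∑ t : ZMod s,
        (∑ u ∈ B₁, ∑ v ∈ B₂, (if IsUnit ((u * v : ℕ) : ZMod s) then
            ((ZMod.stdAddChar (-(t * ((a : ZMod s) * ((u * v : ℕ) : ZMod s)⁻¹))) : ℂ) -
              kloostermanSum s (-t) 0 / (Nat.totient s : ℂ)) else 0)) *
        (∑ w ∈ B₃, (ZMod.stdAddChar (t * (w : ZMod s)) : ℂ)) := by
  classical
  have hslice : ∀ u ∈ B₁, (((∑ v ∈ B₂, ∑ w ∈ B₃, gAP s a (u * v * w) : ℝ)) : ℂ) =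
      (s : ℂ)⁻¹ * ∑ t : ZMod s,
        (∑ v ∈ B₂, (if IsUnit ((u * v : ℕ) : ZMod s) then
            ((ZMod.stdAddChar (-(t * ((a : ZMod s) * ((u * v : ℕ) : ZMod s)⁻¹))) : ℂ) -
              kloostermanSum s (-t) 0 / (Nat.totient s : ℂ)) else 0)) *
        (∑ w ∈ B₃, (ZMod.stdAddChar (t * (w : ZMod s)) : ℂ)) := by
    intro u hu
    have hinj : ∀ x ∈ B₂, ∀ y ∈ B₂, u * x = u * y → x = y := fun x _ y _ h =>
      Nat.eq_of_mul_eq_mul_left (hB₁ u hu) h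
    have e1 : ∑ v ∈ B₂, ∑ w ∈ B₃, gAP s a (u * v * w) =
        ∑ m ∈ B₂.image (fun v => u * v), ∑ w ∈ B₃, gAP s a (m * w) := by
      rw [Finset.sum_image hinj]
    have e2 := lemma412_sum_gAP_eq_fourier ha (B₂.image (fun v => u * v)) B₃
    rw [e1, e2]
    refine congrArg (fun z => (s : ℂ)⁻¹ * z) (Finset.sum_congr rfl fun t _ => ?_)
    refine congrArg (fun z => z * ∑ w ∈ B₃, (ZMod.stdAddChar (t * (w : ZMod s)) : ℂ)) ?_
    exact Finset.sum_image hinj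
  rw [Complex.ofReal_sum, Finset.sum_congr rfl hslice, ← Finset.mul_sum, Finset.sum_comm]
  refine congrArg (fun z => (s : ℂ)⁻¹ * z) (Finset.sum_congr rfl fun t _ => ?_)
  rw [Finset.sum_mul]

/-- `‖F(t)‖ ≤ 1/(2‖tD/s‖)` for the geometric sum over a class `mod D` of an interval, `t ≠ 0`,
`(D, s) = 1`. [folklore] -/
theorem norm_sum_box_stdAddChar_le {s D : ℕ} [NeZero s] (hD : 0 < D) (hDs : D.Coprime s)
    (L R : ℕ) (t₃ : ℤ) {t : ZMod s} (ht : t ≠ 0) :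
    ‖∑ w ∈ (Finset.Ioc L R).filter (fun m : ℕ => (m : ZMod D) = (t₃ : ZMod D)),
        (ZMod.stdAddChar (t * (w : ZMod s)) : ℂ)‖ ≤
      1 / (2 * distInt ((((t * (D : ZMod s)).val : ℕ) : ℝ) / s)) := by
  haveI : NeZero D := ⟨hD.ne'⟩
  set ψ : AddChar (ZMod s) ℂ := ZMod.stdAddChar with hψ
  set Dz : ZMod s := (D : ZMod s) with hDz
  have hDu : IsUnit Dz := (ZMod.isUnit_iff_coprime D s).mpr hDs
  set v₂ : ℤ := ((t₃ : ZMod D).val : ℤ) with hv₂def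
  have hv₂ : (v₂ : ZMod D) = (t₃ : ZMod D) := by
    rw [hv₂def, Int.cast_natCast, ZMod.natCast_zmod_val]
  have hw : t * Dz ≠ 0 := by
    intro h0
    apply ht
    calc t = t * Dz * Dz⁻¹ := by rw [mul_assoc, ZMod.mul_inv_of_unit _ hDu, mul_one]
      _ = 0 := by rw [h0, zero_mul]
  have hF' : ∑ w ∈ (Finset.Ioc L R).filter (fun m : ℕ => (m : ZMod D) = (t₃ : ZMod D)),
      (ψ (t * (w : ZMod s)) : ℂ) = (ψ (t * (v₂ : ZMod s)) : ℂ) *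
        ∑ z ∈ Finset.Ioc (((L : ℤ) - v₂) / D) (((R : ℤ) - v₂) / D), (ψ ((t * Dz) * (z : ZMod s)) : ℂ) := by
    have h1 : ∑ w ∈ (Finset.Ioc L R).filter (fun m : ℕ => (m : ZMod D) = (t₃ : ZMod D)),
        (ψ (t * (w : ZMod s)) : ℂ) =
        ∑ w ∈ (Finset.Ioc L R).filter (fun m : ℕ => (m : ZMod D) = (t₃ : ZMod D)),
          (ψ (t * (((w : ℕ) : ℤ) : ZMod s)) : ℂ) :=
      Finset.sum_congr rfl fun w _ => by rw [Int.cast_natCast]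
    rw [h1, lemma412_sum_filter_eq_sum_Ioc hD L R t₃ v₂ hv₂
      (fun m : ℤ => (ψ (t * ((m : ℤ) : ZMod s)) : ℂ)), Finset.mul_sum]
    refine Finset.sum_congr rfl fun z _ => ?_
    rw [← AddChar.map_add_eq_mul]
    congr 1
    push_cast
    rw [hDz]
    ring
  rw [hF', norm_mul, hψ, ZMod.stdAddChar_apply, Circle.norm_coe, one_mul]
  exact lemma412_norm_sum_Ioc_stdAddChar_le hw _ _

/-- `‖F(t)‖ ≤ #B₃ ≤ (R − L)/D + 1`. [folklore] -/
theorem norm_sum_box_stdAddChar_le_card {s D : ℕ} [NeZero s] (hD : 0 < D) (L R : ℕ) (t₃ : ℤ)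
    (t : ZMod s) :
    ‖∑ w ∈ (Finset.Ioc L R).filter (fun m : ℕ => (m : ZMod D) = (t₃ : ZMod D)),
        (ZMod.stdAddChar (t * (w : ZMod s)) : ℂ)‖ ≤ ((R - L : ℕ) : ℝ) / D + 1 := by
  haveI : NeZero D := ⟨hD.ne'⟩
  calc ‖∑ w ∈ (Finset.Ioc L R).filter (fun m : ℕ => (m : ZMod D) = (t₃ : ZMod D)),
        (ZMod.stdAddChar (t * (w : ZMod s)) : ℂ)‖
      ≤ ∑ w ∈ (Finset.Ioc L R).filter (fun m : ℕ => (m : ZMod D) = (t₃ : ZMod D)),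
        ‖(ZMod.stdAddChar (t * (w : ZMod s)) : ℂ)‖ := norm_sum_le _ _
    _ = ((Finset.Ioc L R).filter (fun m : ℕ => (m : ZMod D) = (t₃ : ZMod D))).card := by
        rw [Finset.sum_congr rfl (fun w _ => by rw [ZMod.stdAddChar_apply, Circle.norm_coe]),
          Finset.sum_const, nsmul_eq_mul, mul_one]
    _ ≤ ((R - L : ℕ) : ℝ) / D + 1 := card_Ioc_filter_natCast_eq_le hD L R _

/-- The `u,v`-sum `E(t)` at a nonzero frequency: for `t ≠ 0`,
`‖∑_{u ∈ B₁} ∑_{v ∈ B₂} [uv unit](e_s(−tα(uv)⁻¹) − S(−t,0;s)/φ(s))‖`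
`≤ ∑_{u ∈ B₁*} ‖∑_{v ∈ B₂*} e_s((−tαū) v̄)‖ + #B₁* #B₂* (t, s)/φ(s)`. [folklore] -/
theorem norm_E_le {s : ℕ} [NeZero s] (α : ZMod s) (B₁ B₂ : Finset ℕ) (t : ZMod s) :
    ‖∑ u ∈ B₁, ∑ v ∈ B₂, (if IsUnit ((u * v : ℕ) : ZMod s) then
        ((ZMod.stdAddChar (-(t * (α * ((u * v : ℕ) : ZMod s)⁻¹))) : ℂ) -
          kloostermanSum s (-t) 0 / (Nat.totient s : ℂ)) else 0)‖ ≤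
      ∑ u ∈ unitsIn s B₁, ‖∑ v ∈ unitsIn s B₂,
          (ZMod.stdAddChar ((-t * α * ((u : ZMod s))⁻¹) * ((v : ZMod s))⁻¹) : ℂ)‖ +
        (unitsIn s B₁).card * (unitsIn s B₂).card * ((Nat.gcd t.val s : ℝ) / Nat.totient s) := by
  classical
  have hs : 0 < s := Nat.pos_of_ne_zero (NeZero.ne s)
  have hφ0 : (0 : ℝ) < Nat.totient s := by exact_mod_cast Nat.totient_pos.mpr hs
  set ψ : AddChar (ZMod s) ℂ := ZMod.stdAddChar with hψ
  set K : ℂ := kloostermanSum s (-t) 0 / (Nat.totient s : ℂ) with hK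
  have hU : unitsIn s B₁ = B₁.filter (fun u : ℕ => IsUnit (u : ZMod s)) := by
    ext u; rw [Finset.mem_filter, mem_unitsIn, ZMod.isUnit_iff_coprime]
  have hV : unitsIn s B₂ = B₂.filter (fun v : ℕ => IsUnit (v : ZMod s)) := by
    ext v; rw [Finset.mem_filter, mem_unitsIn, ZMod.isUnit_iff_coprime]
  -- rewrite the double sum over the units
  have hsum : ∑ u ∈ B₁, ∑ v ∈ B₂, (if IsUnit ((u * v : ℕ) : ZMod s) then
      ((ψ (-(t * (α * ((u * v : ℕ) : ZMod s)⁻¹))) : ℂ) - K) else 0) =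
      ∑ u ∈ unitsIn s B₁, (∑ v ∈ unitsIn s B₂,
        (ψ ((-t * α * ((u : ZMod s))⁻¹) * ((v : ZMod s))⁻¹) : ℂ) - (unitsIn s B₂).card * K) := by
    rw [hU, Finset.sum_filter]
    refine Finset.sum_congr rfl fun u _ => ?_
    split_ifs with hu
    · rw [hV, Finset.sum_filter]
      have hcard : ((B₂.filter (fun v : ℕ => IsUnit (v : ZMod s))).card : ℂ) * K =
          ∑ v ∈ B₂, (if IsUnit (v : ZMod s) then K else 0) := by
        rw [Finset.sum_ite, Finset.sum_const_zero, add_zero, Finset.sum_const, nsmul_eq_mul]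
      rw [hcard, ← Finset.sum_sub_distrib]
      refine Finset.sum_congr rfl fun v _ => ?_
      by_cases hv : IsUnit (v : ZMod s)
      · have huv : IsUnit ((u * v : ℕ) : ZMod s) := by rw [Nat.cast_mul]; exact hu.mul hv
        rw [if_pos huv, if_pos hv, if_pos hv]
        congr 2
        rw [Nat.cast_mul, mul_inv_of_isUnit hu hv]; ring
      · have huv : ¬ IsUnit ((u * v : ℕ) : ZMod s) := by
          rw [Nat.cast_mul]; exact fun h => hv (IsUnit.mul_iff.mp h).2
        rw [if_neg huv, if_neg hv, if_neg hv, sub_zero]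
    · refine Finset.sum_eq_zero fun v _ => ?_
      have huv : ¬ IsUnit ((u * v : ℕ) : ZMod s) := by
        rw [Nat.cast_mul]; exact fun h => hu (IsUnit.mul_iff.mp h).1
      rw [if_neg huv]
  rw [hsum, Finset.sum_sub_distrib, Finset.sum_const, nsmul_eq_mul]
  have hKn : ‖K‖ ≤ (Nat.gcd t.val s : ℝ) / Nat.totient s := by
    rw [hK, norm_div, Complex.norm_natCast]
    apply div_le_div_of_nonneg_right _ hφ0.le
    rw [kloostermanSum_comm]
    refine (norm_kloostermanSum_zero_left_le s (-t)).trans ?_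
    rw [show (-t) = t * (-1) by ring, lemma412_gcd_val_mul_of_isUnit t isUnit_one.neg]
  calc ‖∑ u ∈ unitsIn s B₁, ∑ v ∈ unitsIn s B₂, (ψ ((-t * α * ((u : ZMod s))⁻¹) * ((v : ZMod s))⁻¹) : ℂ) -
          ((unitsIn s B₁).card : ℂ) * (((unitsIn s B₂).card : ℂ) * K)‖
      ≤ ‖∑ u ∈ unitsIn s B₁, ∑ v ∈ unitsIn s B₂, (ψ ((-t * α * ((u : ZMod s))⁻¹) * ((v : ZMod s))⁻¹) : ℂ)‖ +
          ‖((unitsIn s B₁).card : ℂ) * (((unitsIn s B₂).card : ℂ) * K)‖ := norm_sub_le _ _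
    _ ≤ _ := by
        apply add_le_add (norm_sum_le _ _)
        rw [norm_mul, norm_mul, Complex.norm_natCast, Complex.norm_natCast, mul_assoc]
        apply mul_le_mul_of_nonneg_left _ (Nat.cast_nonneg _)
        exact mul_le_mul_of_nonneg_left hKn (Nat.cast_nonneg _)

/-! ### The main term: reduction to (6.3), (6.4), (6.5) -/

/-- The main term to the fourth power: Hölder, then (6.3) and (6.4). [cite: HeathBrown1986d3, §6 (6.2)–(6.4)] -/
theorem main_term_pow_four_le {s : ℕ} [NeZero s] {a' : ZMod s} (ha' : IsUnit a') (Ub : Finset ℕ)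
    {R₁ : ℕ} (hUb : ∀ u ∈ Ub, 1 ≤ u ∧ u ≤ R₁) (hUu : ∀ u ∈ Ub, IsUnit (u : ZMod s))
    (w : ZMod s → ℝ) {K' : ℝ} (hK' : 0 ≤ K') (hw0 : ∀ t, 0 ≤ w t) (hwK : ∀ t, w t ≤ K')
    (hwd : ∀ t, t ≠ 0 → w t ≤ 1 / (2 * distInt (((t.val : ℕ) : ℝ) / s)))
    (Sf : ZMod s → ℝ) (hS0 : ∀ k, 0 ≤ Sf k) {M : ℝ} (hM0 : 0 ≤ M)
    (hM : ∀ n : ℕ, n ≠ 0 → n ≤ 2 * s * R₁ → (n.divisors.card : ℝ) ≤ M) :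
    (∑ p ∈ Ub ×ˢ (Finset.univ.erase (0 : ZMod s)), w p.2 * Sf (a' * p.2 * ((p.1 : ZMod s))⁻¹)) ^ 4 ≤
      (Ub.card * ((s : ℝ) * (1 + Real.log s))) ^ 2 *
        (4 * ((Nat.log 2 s : ℝ) + 1) ^ 2 * M * s * Ub.card * (R₁ + K')) *
          ∑ k : ZMod s, Sf k ^ 4 := by
  classical
  have hs : 0 < s := Nat.pos_of_ne_zero (NeZero.ne s)
  have hsR : (0 : ℝ) < s := by exact_mod_cast hs
  set P := Ub ×ˢ (Finset.univ.erase (0 : ZMod s)) with hP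
  set key : ℕ × ZMod s → ZMod s := fun p => a' * p.2 * ((p.1 : ZMod s))⁻¹ with hkey
  have h1 := holder_main P (fun p => w p.2) (fun p _ => hw0 _) key Sf hS0
  have hN : ∑ k : ZMod s, ∑ p ∈ P.filter (fun p => key p = k), w p.2 ≤
      Ub.card * ((s : ℝ) * (1 + Real.log s)) := sum_nk_le Ub key hwd
  have hN0 : 0 ≤ ∑ k : ZMod s, ∑ p ∈ P.filter (fun p => key p = k), w p.2 :=
    Finset.sum_nonneg fun k _ => Finset.sum_nonneg fun p _ => hw0 _
  have hws : ∀ t : ZMod s, t ≠ 0 → w t * (2 * d0 t) ≤ s := by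
    intro t ht
    have hd := d0_div_le_distInt t
    have hd0 : (0 : ℝ) < d0 t := by exact_mod_cast d0_pos ht
    have hdist : 0 < distInt (((t.val : ℕ) : ℝ) / s) := lt_of_lt_of_le (by positivity) hd
    have := hwd t ht
    calc w t * (2 * d0 t) ≤ 1 / (2 * distInt (((t.val : ℕ) : ℝ) / s)) * (2 * d0 t) := by gcongr
      _ ≤ 1 / (2 * ((d0 t : ℝ) / s)) * (2 * d0 t) := by gcongr
      _ = s := by field_simp
  have hN2 : ∑ k : ZMod s, (∑ p ∈ P.filter (fun p => key p = k), w p.2) ^ 2 ≤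
      4 * ((Nat.log 2 s : ℝ) + 1) ^ 2 * M * s * Ub.card * (R₁ + K') :=
    sum_sq_nk_le ha' hUb hUu hK' hw0 hwK hws hM0 hM
  have hS4 : 0 ≤ ∑ k : ZMod s, Sf k ^ 4 := Finset.sum_nonneg fun k _ => by positivity
  calc (∑ p ∈ P, w p.2 * Sf (key p)) ^ 4
      ≤ (∑ k : ZMod s, ∑ p ∈ P.filter (fun p => key p = k), w p.2) ^ 2 *
          (∑ k : ZMod s, (∑ p ∈ P.filter (fun p => key p = k), w p.2) ^ 2) *
            ∑ k : ZMod s, Sf k ^ 4 := h1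
    _ ≤ (Ub.card * ((s : ℝ) * (1 + Real.log s))) ^ 2 *
          (4 * ((Nat.log 2 s : ℝ) + 1) ^ 2 * M * s * Ub.card * (R₁ + K')) *
            ∑ k : ZMod s, Sf k ^ 4 := by
        gcongr

/-- Fourth roots: `x⁴ ≤ s⁴ Q`, `x, Q ≥ 0` ⟹ `x/s ≤ Q^{1/4}`. [folklore] -/
theorem div_le_rpow_quarter {x s Q : ℝ} (hx : 0 ≤ x) (hs : 0 < s) (hQ : 0 ≤ Q)
    (h : x ^ 4 ≤ s ^ 4 * Q) : x / s ≤ Q ^ (1 / 4 : ℝ) := by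
  rw [div_le_iff₀ hs]
  have e1 : x = (x ^ 4) ^ (1 / 4 : ℝ) := by
    rw [show (1 / 4 : ℝ) = ((4 : ℕ) : ℝ)⁻¹ by norm_num, Real.pow_rpow_inv_natCast hx (by norm_num)]
  have e2 : (s ^ 4 * Q) ^ (1 / 4 : ℝ) = s * Q ^ (1 / 4 : ℝ) := by
    rw [Real.mul_rpow (by positivity) hQ]
    congr 1
    rw [show (1 / 4 : ℝ) = ((4 : ℕ) : ℝ)⁻¹ by norm_num, Real.pow_rpow_inv_natCast hs.le (by norm_num)]
  calc x = (x ^ 4) ^ (1 / 4 : ℝ) := e1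
    _ ≤ (s ^ 4 * Q) ^ (1 / 4 : ℝ) := Real.rpow_le_rpow (by positivity) h (by norm_num)
    _ = s * Q ^ (1 / 4 : ℝ) := e2
    _ = Q ^ (1 / 4 : ℝ) * s := mul_comm _ _

/-! ### Heath-Brown's Lemma 7 for `g_s` over boxes with classes `mod D` -/

set_option maxHeartbeats 800000 in
/-- **Heath-Brown's second auxiliary bound (Acta Arith. 47 (1986), Lemma 7) in Fouvry–Tenenbaum's
form** — `g_s` summed over a product of three boxes with classes `mod D`, `(D, s) = 1`:
for every `ε > 0` there is `C` such that, for `(a, s) = 1`, boxes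
`B₁ = {L₁ < u ≤ R₁ : u ≡ t₁ (D)}`, `B₂ = {A < v ≤ B : v ≡ t₂ (D)} ⊆ (V, 2V]` (`1 ≤ V ≤ A`, `B ≤ 2V`),
`B₃ = {L₃ < w ≤ R₃ : w ≡ t₃ (D)}`, and any `M ≥ d(n)` (`0 < n ≤ 2sR₁`),
`|∑_{u ∈ B₁} ∑_{v ∈ B₂} ∑_{w ∈ B₃} g_s(uvw; a)|`
`≤ (C (sV)^ε d(s) M (1 + log s)² (log₂ s + 1)² · #B₁³ (R₁ + (R₃ − L₃)/D + 1) ((B − A) + 1)²`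
`(1 + V²/s + V^{3/2}s^{−1/2}))^{1/4} + #B₁ #B₂ d(s)(1 + log s)/φ(s)`
(Heath-Brown: "`N(U, V, W) − N₁(U, V, W) ≪ X^ε I^{3/4} J^{1/2} (K + U)^{1/4}`
`{1 + V²q⁻¹ + V^{3/2}q^{−1/2}}^{1/4}`"; here `N − N₁` is the sum of `g_s`, the `X^ε` is unpacked as
`((sV)^ε d(s) M (1+log s)²(log₂ s+1)²)^{1/4}`, the last term accounts for the difference between
`N₁ = q⁻¹∑∑F_q(0)` and the `φ(s)`-normalised main term inside `g_s`, and `K + U` becomes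
`(R₃ − L₃)/D + 1 + R₁`).  Proof as printed, §6: Fourier expansion in `w` ((2.8)), Hölder (6.2),
(6.3), (6.4) (`sum_sq_nk_le`), (6.5) (`sum_norm_pow_four_eq`) and the energy bound (6.13)
(`invEnergy_le`); the classes `mod D` enter through `a ↦ −aD̄`, `t ↦ tD` and the monotonicity of all
counts in the boxes. [cite: HeathBrown1986d3, Lemma 7] -/
theorem sum3_gAP_le {ε : ℝ} (hε : 0 < ε) :
    ∃ C : ℝ, 0 < C ∧ ∀ (s D : ℕ) [NeZero s] (a t₁ t₂ t₃ : ℤ) (L₁ R₁ A B L₃ R₃ : ℕ) (V M : ℝ),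
      0 < D → D.Coprime s → IsUnit (a : ZMod s) → 1 ≤ V → V ≤ (A : ℝ) → (B : ℝ) ≤ 2 * V →
      0 ≤ M → (∀ n : ℕ, n ≠ 0 → n ≤ 2 * s * R₁ → (n.divisors.card : ℝ) ≤ M) →
      |∑ u ∈ (Finset.Ioc L₁ R₁).filter (fun m : ℕ => (m : ZMod D) = (t₁ : ZMod D)),
          ∑ v ∈ (Finset.Ioc A B).filter (fun m : ℕ => (m : ZMod D) = (t₂ : ZMod D)),
            ∑ w ∈ (Finset.Ioc L₃ R₃).filter (fun m : ℕ => (m : ZMod D) = (t₃ : ZMod D)),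
              gAP s a (u * v * w)| ≤
        (C * ((s : ℝ) * V) ^ ε * (Nat.divisors s).card * M * (1 + Real.log s) ^ 2 *
            ((Nat.log 2 s : ℝ) + 1) ^ 2 *
            (((Finset.Ioc L₁ R₁).filter (fun m : ℕ => (m : ZMod D) = (t₁ : ZMod D))).card : ℝ) ^ 3 *
            ((R₁ : ℝ) + (((R₃ - L₃ : ℕ) : ℝ) / D + 1)) * ((((B - A : ℕ) : ℝ) + 1) ^ 2 *
            (1 + V ^ 2 / s + V * Real.sqrt V / Real.sqrt s))) ^ (1 / 4 : ℝ) +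
          (((Finset.Ioc L₁ R₁).filter (fun m : ℕ => (m : ZMod D) = (t₁ : ZMod D))).card : ℝ) *
            (((Finset.Ioc A B).filter (fun m : ℕ => (m : ZMod D) = (t₂ : ZMod D))).card : ℝ) *
            (Nat.divisors s).card * (1 + Real.log s) / Nat.totient s := by
  obtain ⟨CH, hCH0, hCH⟩ := invEnergy_le hε
  refine ⟨4 * CH, by positivity, ?_⟩
  intro s D _ a t₁ t₂ t₃ L₁ R₁ A B L₃ R₃ V M hD hDs ha hV hVA hBV hM0 hM
  classical
  have hs : 0 < s := Nat.pos_of_ne_zero (NeZero.ne s)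
  have hsR : (0 : ℝ) < s := by exact_mod_cast hs
  have hs1 : (1 : ℝ) ≤ s := by exact_mod_cast hs
  have hφ0 : (0 : ℝ) < Nat.totient s := by exact_mod_cast Nat.totient_pos.mpr hs
  have hlog : 0 ≤ 1 + Real.log s := by have := Real.log_nonneg hs1; linarith
  haveI : NeZero D := ⟨hD.ne'⟩
  set box₁ := (Finset.Ioc L₁ R₁).filter (fun m : ℕ => (m : ZMod D) = (t₁ : ZMod D)) with hbox₁
  set box₂ := (Finset.Ioc A B).filter (fun m : ℕ => (m : ZMod D) = (t₂ : ZMod D)) with hbox₂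
  set box₃ := (Finset.Ioc L₃ R₃).filter (fun m : ℕ => (m : ZMod D) = (t₃ : ZMod D)) with hbox₃
  set ψ : AddChar (ZMod s) ℂ := ZMod.stdAddChar with hψ
  set α : ZMod s := (a : ZMod s) with hα
  set Dz : ZMod s := (D : ZMod s) with hDz
  have hDu : IsUnit Dz := (ZMod.isUnit_iff_coprime D s).mpr hDs
  set Ub := unitsIn s box₁ with hUb
  set Vb := unitsIn s box₂ with hVb
  set τ : ℝ := ((Nat.divisors s).card : ℝ) with hτ
  set K' : ℝ := ((R₃ - L₃ : ℕ) : ℝ) / D + 1 with hK'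
  have hK'0 : 0 ≤ K' := by positivity
  set Pfac : ℝ := 1 + V ^ 2 / s + V * Real.sqrt V / Real.sqrt s with hPfac
  set J' : ℝ := ((B - A : ℕ) : ℝ) + 1 with hJ'
  -- the pieces of the Fourier expansion
  set E : ZMod s → ℂ := fun t => ∑ u ∈ box₁, ∑ v ∈ box₂, (if IsUnit ((u * v : ℕ) : ZMod s) then
      ((ψ (-(t * (α * ((u * v : ℕ) : ZMod s)⁻¹))) : ℂ) - kloostermanSum s (-t) 0 / (Nat.totient s : ℂ))
        else 0) with hE
  set F : ZMod s → ℂ := fun t => ∑ w ∈ box₃, (ψ (t * (w : ZMod s)) : ℂ) with hF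
  set Sv : ZMod s → ℂ := fun k => ∑ v ∈ Vb, (ψ (k * ((v : ZMod s))⁻¹) : ℂ) with hSv
  set Φ : ZMod s → ℝ := fun w => 1 / (2 * distInt (((w.val : ℕ) : ℝ) / s)) with hΦ
  have hΦ0 : ∀ w, 0 ≤ Φ w := fun w => by
    simp only [hΦ]; exact div_nonneg zero_le_one (mul_nonneg zero_le_two (distInt_nonneg _))
  -- Step 1: Fourier identity
  have hbox₁1 : ∀ u ∈ box₁, 1 ≤ u := fun u hu => by
    have := (Finset.mem_Ioc.mp (Finset.mem_filter.mp hu).1).1; omega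
  have hid : (((∑ u ∈ box₁, ∑ v ∈ box₂, ∑ w ∈ box₃, gAP s a (u * v * w) : ℝ)) : ℂ) =
      (s : ℂ)⁻¹ * ∑ t : ZMod s, E t * F t := sum_gAP_three_eq_fourier ha box₁ box₂ box₃ hbox₁1
  -- Step 2: the zero frequency vanishes
  have hφC : (Nat.totient s : ℂ) ≠ 0 := Nat.cast_ne_zero.mpr (Nat.totient_pos.mpr hs).ne'
  have hE0 : E 0 = 0 := by
    simp only [hE]
    refine Finset.sum_eq_zero fun u _ => Finset.sum_eq_zero fun v _ => ?_
    split_ifs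
    · simp [lemma412_kloostermanSum_zero_zero, hφC]
    · rfl
  -- Step 3: bounds for `E(t)` and `F(t)`
  have hEt : ∀ t : ZMod s, ‖E t‖ ≤ ∑ u ∈ Ub, ‖Sv (-t * α * ((u : ZMod s))⁻¹)‖ +
      Ub.card * Vb.card * ((Nat.gcd t.val s : ℝ) / Nat.totient s) := fun t => norm_E_le α box₁ box₂ t
  have hFt : ∀ t : ZMod s, t ≠ 0 → ‖F t‖ ≤ Φ (t * Dz) := fun t ht =>
    norm_sum_box_stdAddChar_le hD hDs L₃ R₃ t₃ ht
  have hFK : ∀ t : ZMod s, ‖F t‖ ≤ K' := fun t => norm_sum_box_stdAddChar_le_card hD L₃ R₃ t₃ t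
  -- Step 4: `|Σ| ≤ s⁻¹ (M₁ + Sec)`
  set M₁ : ℝ := ∑ t ∈ (Finset.univ : Finset (ZMod s)).erase 0,
      ‖F t‖ * ∑ u ∈ Ub, ‖Sv (-t * α * ((u : ZMod s))⁻¹)‖ with hM₁
  set Sec : ℝ := ∑ t ∈ (Finset.univ : Finset (ZMod s)).erase 0,
      ‖F t‖ * (Ub.card * Vb.card * ((Nat.gcd t.val s : ℝ) / Nat.totient s)) with hSec
  have habs : |∑ u ∈ box₁, ∑ v ∈ box₂, ∑ w ∈ box₃, gAP s a (u * v * w)| ≤ (s : ℝ)⁻¹ * (M₁ + Sec) := by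
    have e : |∑ u ∈ box₁, ∑ v ∈ box₂, ∑ w ∈ box₃, gAP s a (u * v * w)| =
        ‖(((∑ u ∈ box₁, ∑ v ∈ box₂, ∑ w ∈ box₃, gAP s a (u * v * w) : ℝ)) : ℂ)‖ := by
      rw [Complex.norm_real, Real.norm_eq_abs]
    rw [e, hid, norm_mul, norm_inv, Complex.norm_natCast]
    apply mul_le_mul_of_nonneg_left _ (by positivity)
    have h0 : E 0 * F 0 = 0 := by rw [hE0, zero_mul]
    rw [← Finset.sum_erase (f := fun t => E t * F t) Finset.univ h0]
    calc ‖∑ t ∈ (Finset.univ : Finset (ZMod s)).erase 0, E t * F t‖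
        ≤ ∑ t ∈ (Finset.univ : Finset (ZMod s)).erase 0, ‖E t * F t‖ := norm_sum_le _ _
      _ ≤ ∑ t ∈ (Finset.univ : Finset (ZMod s)).erase 0,
            (‖F t‖ * ∑ u ∈ Ub, ‖Sv (-t * α * ((u : ZMod s))⁻¹)‖ +
              ‖F t‖ * (Ub.card * Vb.card * ((Nat.gcd t.val s : ℝ) / Nat.totient s))) := by
          refine Finset.sum_le_sum fun t _ => ?_
          rw [norm_mul, ← mul_add, mul_comm]
          exact mul_le_mul_of_nonneg_left (hEt t) (norm_nonneg _)
      _ = M₁ + Sec := by rw [Finset.sum_add_distrib]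
  -- Step 5: the secondary term
  have hSec : Sec ≤ Ub.card * Vb.card * (τ * s * (1 + Real.log s)) / Nat.totient s := by
    have e : Sec = (Ub.card * Vb.card / Nat.totient s : ℝ) *
        ∑ t ∈ (Finset.univ : Finset (ZMod s)).erase 0, ‖F t‖ * (Nat.gcd t.val s : ℝ) := by
      rw [hSec, Finset.mul_sum]
      refine Finset.sum_congr rfl fun t _ => ?_; ring
    rw [e]
    have hsum : ∑ t ∈ (Finset.univ : Finset (ZMod s)).erase 0, ‖F t‖ * (Nat.gcd t.val s : ℝ) ≤
        τ * s * (1 + Real.log s) := by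
      calc ∑ t ∈ (Finset.univ : Finset (ZMod s)).erase 0, ‖F t‖ * (Nat.gcd t.val s : ℝ)
          ≤ ∑ t ∈ (Finset.univ : Finset (ZMod s)).erase 0,
              (Nat.gcd (t * Dz).val s : ℝ) * Φ (t * Dz) := by
            refine Finset.sum_le_sum fun t ht => ?_
            have ht0 : t ≠ 0 := Finset.ne_of_mem_erase ht
            rw [lemma412_gcd_val_mul_of_isUnit t hDu, mul_comm]
            exact mul_le_mul_of_nonneg_left (hFt t ht0) (Nat.cast_nonneg _)
        _ = ∑ w ∈ (Finset.univ : Finset (ZMod s)).erase 0, (Nat.gcd w.val s : ℝ) * Φ w := by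
            refine Finset.sum_nbij' (fun t => t * Dz) (fun w => w * Dz⁻¹) (fun t ht => ?_)
              (fun w hw => ?_) (fun t _ => ?_) (fun w _ => ?_) (fun t _ => rfl)
            · rw [Finset.mem_erase] at ht ⊢
              refine ⟨fun h0 => ht.1 ?_, Finset.mem_univ _⟩
              have : t * Dz * Dz⁻¹ = 0 := by rw [h0, zero_mul]
              rwa [mul_assoc, ZMod.mul_inv_of_unit _ hDu, mul_one] at this
            · rw [Finset.mem_erase] at hw ⊢
              refine ⟨fun h0 => hw.1 ?_, Finset.mem_univ _⟩
              have : w * Dz⁻¹ * Dz = 0 := by rw [h0, zero_mul]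
              rwa [mul_assoc, mul_comm (Dz⁻¹), ZMod.mul_inv_of_unit _ hDu, mul_one] at this
            · rw [mul_assoc, ZMod.mul_inv_of_unit _ hDu, mul_one]
            · rw [mul_assoc, mul_comm (Dz⁻¹), ZMod.mul_inv_of_unit _ hDu, mul_one]
        _ ≤ τ * s * (1 + Real.log s) := by
            have := lemma412_sum_gcd_div_distInt_le s
            simpa only [hΦ, hτ] using this
    calc (Ub.card * Vb.card / Nat.totient s : ℝ) *
          ∑ t ∈ (Finset.univ : Finset (ZMod s)).erase 0, ‖F t‖ * (Nat.gcd t.val s : ℝ)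
        ≤ (Ub.card * Vb.card / Nat.totient s : ℝ) * (τ * s * (1 + Real.log s)) :=
          mul_le_mul_of_nonneg_left hsum (by positivity)
      _ = _ := by ring
  -- Step 6: the main term, re-indexed by `t = t' D̄`
  set a' : ZMod s := -α * Dz⁻¹ with ha'
  have hDinv : IsUnit Dz⁻¹ := IsUnit.of_mul_eq_one Dz (by rw [mul_comm, ZMod.mul_inv_of_unit _ hDu])
  have ha'u : IsUnit a' := (ha.neg).mul hDinv
  set w : ZMod s → ℝ := fun t' => ‖F (t' * Dz⁻¹)‖ with hw
  set Sf : ZMod s → ℝ := fun k => ‖Sv k‖ with hSf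
  have hM₁eq : M₁ = ∑ p ∈ Ub ×ˢ (Finset.univ.erase (0 : ZMod s)),
      w p.2 * Sf (a' * p.2 * ((p.1 : ZMod s))⁻¹) := by
    rw [hM₁, Finset.sum_product_right]
    refine Finset.sum_nbij' (fun t => t * Dz) (fun t' => t' * Dz⁻¹) (fun t ht => ?_)
      (fun w hw => ?_) (fun t _ => ?_) (fun w _ => ?_) (fun t _ => ?_)
    · rw [Finset.mem_erase] at ht ⊢
      refine ⟨fun h0 => ht.1 ?_, Finset.mem_univ _⟩
      have : t * Dz * Dz⁻¹ = 0 := by rw [h0, zero_mul]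
      rwa [mul_assoc, ZMod.mul_inv_of_unit _ hDu, mul_one] at this
    · rw [Finset.mem_erase] at hw ⊢
      refine ⟨fun h0 => hw.1 ?_, Finset.mem_univ _⟩
      have : w * Dz⁻¹ * Dz = 0 := by rw [h0, zero_mul]
      rwa [mul_assoc, mul_comm (Dz⁻¹), ZMod.mul_inv_of_unit _ hDu, mul_one] at this
    · rw [mul_assoc, ZMod.mul_inv_of_unit _ hDu, mul_one]
    · rw [mul_assoc, mul_comm (Dz⁻¹), ZMod.mul_inv_of_unit _ hDu, mul_one]
    · simp only [hw, hSf]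
      rw [mul_assoc t Dz, ZMod.mul_inv_of_unit _ hDu, mul_one, Finset.mul_sum]
      refine Finset.sum_congr rfl fun u _ => ?_
      have e : -t * α * ((u : ZMod s))⁻¹ = a' * (t * Dz) * ((u : ZMod s))⁻¹ := by
        rw [ha']
        calc -t * α * ((u : ZMod s))⁻¹ = -t * α * 1 * ((u : ZMod s))⁻¹ := by rw [mul_one]
          _ = -t * α * (Dz * Dz⁻¹) * ((u : ZMod s))⁻¹ := by rw [ZMod.mul_inv_of_unit _ hDu]
          _ = -α * Dz⁻¹ * (t * Dz) * ((u : ZMod s))⁻¹ := by ring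
      rw [e]
  -- hypotheses of `main_term_pow_four_le`
  have hUb1 : ∀ u ∈ Ub, 1 ≤ u ∧ u ≤ R₁ := fun u hu => by
    have h := Finset.mem_Ioc.mp (Finset.mem_filter.mp (mem_unitsIn.mp hu).1).1
    exact ⟨by omega, h.2⟩
  have hUu : ∀ u ∈ Ub, IsUnit (u : ZMod s) := fun u hu =>
    (ZMod.isUnit_iff_coprime u s).mpr (mem_unitsIn.mp hu).2
  have hw0 : ∀ t, 0 ≤ w t := fun t => norm_nonneg _
  have hwK : ∀ t, w t ≤ K' := fun t => hFK _
  have hwd : ∀ t : ZMod s, t ≠ 0 → w t ≤ 1 / (2 * distInt (((t.val : ℕ) : ℝ) / s)) := by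
    intro t ht
    have ht' : t * Dz⁻¹ ≠ 0 := by
      intro h0
      apply ht
      have : t * Dz⁻¹ * Dz = 0 := by rw [h0, zero_mul]
      rwa [mul_assoc, mul_comm (Dz⁻¹), ZMod.mul_inv_of_unit _ hDu, mul_one] at this
    have := hFt (t * Dz⁻¹) ht'
    rwa [mul_assoc, mul_comm (Dz⁻¹), ZMod.mul_inv_of_unit _ hDu, mul_one] at this
  have hS0 : ∀ k, 0 ≤ Sf k := fun k => norm_nonneg _
  have hmain4 := main_term_pow_four_le ha'u Ub hUb1 hUu w hK'0 hw0 hwK hwd Sf hS0 hM0 hM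
  -- (6.5) and (6.13)
  have hS4 : ∑ k : ZMod s, Sf k ^ 4 = (s : ℝ) * (invEnergy s box₂ : ℕ) := sum_norm_pow_four_eq s box₂
  have hbox₂ : box₂ ⊆ Finset.Ioc A B := Finset.filter_subset _ _
  have hH : ((invEnergy s box₂ : ℕ) : ℝ) ≤ CH * ((s : ℝ) * V) ^ ε * τ * (J' ^ 2 * Pfac) :=
    hCH s V A B box₂ hV hVA hBV hbox₂
  -- sizes
  have hUbcard : (Ub.card : ℝ) ≤ box₁.card := by exact_mod_cast card_unitsIn_le box₁
  have hVbcard : (Vb.card : ℝ) ≤ box₂.card := by exact_mod_cast card_unitsIn_le box₂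
  set Q : ℝ := 4 * CH * ((s : ℝ) * V) ^ ε * τ * M * (1 + Real.log s) ^ 2 * ((Nat.log 2 s : ℝ) + 1) ^ 2 *
      (box₁.card : ℝ) ^ 3 * ((R₁ : ℝ) + K') * (J' ^ 2 * Pfac) with hQ
  have hQ0 : 0 ≤ Q := by positivity
  have hM₁0 : 0 ≤ M₁ := Finset.sum_nonneg fun t _ =>
    mul_nonneg (norm_nonneg _) (Finset.sum_nonneg fun u _ => norm_nonneg _)
  have hM₁4 : M₁ ^ 4 ≤ (s : ℝ) ^ 4 * Q := by
    rw [hM₁eq]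
    refine hmain4.trans ?_
    rw [hS4]
    calc (Ub.card * ((s : ℝ) * (1 + Real.log s))) ^ 2 *
          (4 * ((Nat.log 2 s : ℝ) + 1) ^ 2 * M * s * Ub.card * (R₁ + K')) *
            ((s : ℝ) * (invEnergy s box₂ : ℕ))
        ≤ (box₁.card * ((s : ℝ) * (1 + Real.log s))) ^ 2 *
          (4 * ((Nat.log 2 s : ℝ) + 1) ^ 2 * M * s * box₁.card * (R₁ + K')) *
            ((s : ℝ) * (CH * ((s : ℝ) * V) ^ ε * τ * (J' ^ 2 * Pfac))) := by gcongr
      _ = (s : ℝ) ^ 4 * Q := by rw [hQ]; ring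
  have hmain : M₁ / s ≤ Q ^ (1 / 4 : ℝ) := div_le_rpow_quarter hM₁0 hsR hQ0 hM₁4
  -- Step 7: conclusion
  have hSec' : Sec / s ≤ box₁.card * box₂.card * τ * (1 + Real.log s) / Nat.totient s := by
    rw [div_le_iff₀ hsR]
    calc Sec ≤ Ub.card * Vb.card * (τ * s * (1 + Real.log s)) / Nat.totient s := hSec
      _ ≤ box₁.card * box₂.card * (τ * s * (1 + Real.log s)) / Nat.totient s := by gcongr
      _ = box₁.card * box₂.card * τ * (1 + Real.log s) / Nat.totient s * s := by ring
  calc |∑ u ∈ box₁, ∑ v ∈ box₂, ∑ w ∈ box₃, gAP s a (u * v * w)| ≤ (s : ℝ)⁻¹ * (M₁ + Sec) := habs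
    _ = M₁ / s + Sec / s := by field_simp
    _ ≤ Q ^ (1 / 4 : ℝ) + box₁.card * box₂.card * τ * (1 + Real.log s) / Nat.totient s :=
        add_le_add hmain hSec'
    _ = _ := by rw [hQ]


end HeathBrown1986

end Literature.NumberTheory.Sieve

end
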